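import Literature.Analysis.FunctionSpaces.BMOCarlesonConverse
import Literature.Analysis.FunctionSpaces.BMOJohnNirenberg
import HarnessLib

/-!
# Koch–Tataru's converse, II: the potential `Φ`, `div Φ = u`, and Theorem 1 from John–Nirenberg

Topic `Analysis/FunctionSpaces`; sixth file of the Koch–Tataru cluster, sequel of
`BMOCarlesonConverse.lean`. It **proves the converse direction of Koch–Tataru's Theorem 1 in
`BMO` form** (`Literature.Analysis.FunctionSpaces.memBMOInv_of_eCarlesonNorm_lt_top`: a locally integrable tempered `u` with
`sup_{x,R} R^{-d}∫₀^{R²}∫_{B(x,R)} |e^{tΔ}u|² < ∞` is the weak divergence of a vector field with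
`BMO` components), discharges the named fact (D)
`Literature.BMOInv.exists_hasWeakDivergenceRepresentation_of_eCarlesonNorm_lt_top` from the
John–Nirenberg inequality (`…_of_JN`), and assembles
`Literature.memBMOInv_iff_carleson_heat_of_JN : john_nirenberg → memBMOInv_iff_carleson_heat`;
with `Literature.Analysis.FunctionSpaces.john_nirenberg_holds` (`BMOJohnNirenberg.lean`) this **discharges Koch–Tataru's
Theorem 1**: `Literature.memBMOInv_iff_carleson_heat_holds : memBMOInv_iff_carleson_heat`, and
likewise discharges (D) unconditionally:
`Literature.Analysis.FunctionSpaces.exists_hasWeakDivergenceRepresentation_of_eCarlesonNorm_lt_top_holds`.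

## The proof (Koch–Tataru 2001, proof of Theorem 1, p. 10–11, `fⁱ = ∂ᵢΔ⁻¹u`)

* `§ NearField`: by the pairing identity and the small-time estimate of part I,
  `∫_ε^1 ∇e^{sΔ}u ds` is Cauchy in `L²(B)` on every ball; a diagonal choice of `εₙ ↓ 0` gives
  summable Cauchy bounds on all balls `B(0, 2ʲ)`, a.e. convergence
  (`ae_tendsto_of_cauchy_eLpNorm`), a strongly measurable limit `Φ₀` and, by Fatou, convergence in
  `L²_loc`; the pairing identity passes to the limit:
  `∫ g ⟪Φ₀, v⟫ = -2 ∫∫_{(0,1/2) × E} e^{tΔ}u ⟪∇e^{tΔ}g, v⟫`.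
* `§ FarField`: `∫_1^∞ (∇e^{sΔ}u (x) - ∇e^{sΔ}u (0)) ds` converges absolutely by the Lipschitz
  bound of part I; paired with a *mean-zero* atom the renormalising constant drops out.
* `§ Potential`: `Φ = -(Φ₀ + far field)` satisfies
  `∫ g ⟪Φ, v⟫ = 2 ∫∫_{(0,∞) × E} e^{tΔ}u ⟪∇e^{tΔ}g, v⟫`, so `|∫ g ⟪Φ, v⟫| ≤ ‖v‖(A₁γ + A₂M²)ρ^d` and
  the components of `Φ` are in `BMO` (the duality step of `BMOCarlesonDuality.lean`).
* `§ Calculus`, `§ Symmetry`, `§ WeakDiv`: `div Φ = u` weakly: with `gᵢ = ∂ᵢφ` (mean-zero atoms)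
  `-∫ ⟪Φ, ∇φ⟫ = -2 ∫∫ e^{tΔ}u · e^{tΔ}Δφ`, and on slabs
  `∫∫_{(a,c) × E} e^{tΔ}u · e^{tΔ}Δφ = ½(∫ u e^{2cΔ}φ - ∫ u e^{2aΔ}φ) → -½ ∫ u φ`
  (symmetry of `e^{tΔ}`, `e^{sΔ}Δφ = ∂ₛe^{sΔ}φ` by two integrations by parts, `e^{aΔ}φ → φ`,
  and `|e^{bΔ}u| ≤ Cγ^{1/2}b^{-1/2} → 0`).

Only theorems are declared (no new definitions).

## References

* H. Koch, D. Tataru, *Well-posedness for the Navier–Stokes equations*, Adv. Math. 157 (2001),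
  Definition 1.1, Theorem 1 and its proof (§4, (22), Lemma 4.1).
* C. Fefferman, E. M. Stein, *Hᵖ spaces of several variables*, Acta Math. 129 (1972), Thm 3.
* E. M. Stein, *Harmonic Analysis* (1993), Chapter IV, §4.3–4.4.
-/

noncomputable section

open MeasureTheory Metric Filter Topology
open scoped ENNReal NNReal RealInnerProductSpace Convolution

namespace Literature.Analysis.FunctionSpaces

namespace BMOInv

/-! ## The near field: `L²`-Cauchy property of `∫_ε^1 ∇e^{sΔ}u ds` -/

section NearField

variable {E : Type*} [NormedAddCommGroup E] [InnerProductSpace ℝ E] [FiniteDimensional ℝ E]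
  [MeasurableSpace E] [BorelSpace E]

/-- `eLpNorm f 2 μ = (∫⁻ ‖f‖ₑ²)^{1/2}`. [folklore] -/
theorem eLpNorm_two_eq_rpow {α F : Type*} [MeasurableSpace α] [NormedAddCommGroup F] (μ : Measure α)
    (f : α → F) : eLpNorm f 2 μ = (∫⁻ x, ‖f x‖ₑ ^ 2 ∂μ) ^ (1 / 2 : ℝ) := by
  rw [eLpNorm_eq_lintegral_rpow_enorm_toReal two_ne_zero ENNReal.ofNat_ne_top, ENNReal.toReal_ofNat]
  congr 1
  refine lintegral_congr fun x => ?_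
  rw [show (2 : ℝ) = ((2 : ℕ) : ℝ) by norm_num, ENNReal.rpow_natCast]

/-- The truncated potential `x ↦ ∫_{s ∈ S} ∇e^{sΔ}u (x) ds` is strongly measurable. [folklore] -/
theorem stronglyMeasurable_setIntegral_heatExtensionGrad {u : E → ℝ} (hu : AEStronglyMeasurable u volume)
    (S : Set ℝ) : StronglyMeasurable fun x : E => ∫ s in S, heatExtensionGrad u s x :=
  ((measurable_heatExtensionGrad hu).stronglyMeasurable).integral_prod_left

/-- **Uniform bound for the truncated potential**: for `0 < ε ≤ T`,
`‖∫_ε^T ∇e^{sΔ}u (x) ds‖ ≤ C γ^{1/2} (T - ε)/ε`. [folklore] -/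
theorem norm_setIntegral_heatExtensionGrad_le {C : ℝ}
    (hC : ∀ {u : E → ℝ} {K : ℕ}, (Integrable fun w => ((1 + ‖w‖) ^ K)⁻¹ * u w) → eCarlesonNorm u < ∞ →
      ∀ {t : ℝ}, 0 < t → ∀ y : E, ‖heatExtensionGrad u t y‖ ≤ C * Real.sqrt (eCarlesonNorm u).toReal / t)
    {u : E → ℝ} {K : ℕ} (hfw : Integrable fun w => ((1 + ‖w‖) ^ K)⁻¹ * u w) (hγ : eCarlesonNorm u < ∞)
    {ε T : ℝ} (hε : 0 < ε) (hεT : ε ≤ T) (x : E) :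
    ‖∫ s in Set.Ioo ε T, heatExtensionGrad u s x‖ ≤ C * Real.sqrt (eCarlesonNorm u).toReal / ε * (T - ε) := by
  have h0 : 0 ≤ C * Real.sqrt (eCarlesonNorm u).toReal := by
    have := hC hfw hγ one_pos x
    rw [div_one] at this
    exact (norm_nonneg _).trans this
  have h := norm_setIntegral_le_of_norm_le_const (μ := volume) (s := Set.Ioo ε T)
    (f := fun s => heatExtensionGrad u s x) (C := C * Real.sqrt (eCarlesonNorm u).toReal / ε)
    measure_Ioo_lt_top ?_
  · rwa [measureReal_def, Real.volume_Ioo, ENNReal.toReal_ofReal (by linarith)] at h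
  · intro s hs
    exact (hC hfw hγ (hε.trans hs.1) x).trans (div_le_div_of_nonneg_left h0 hε hs.1.le)

/-- Interval additivity of the truncated potential: for `0 < ε' ≤ ε ≤ T`,
`∫_{ε'}^T - ∫_ε^T = ∫_{ε'}^ε`. [folklore] -/
theorem setIntegral_Ioo_sub_setIntegral_Ioo {u : E → ℝ} {K : ℕ}
    (hfw : Integrable fun w => ((1 + ‖w‖) ^ K)⁻¹ * u w) {ε' ε T : ℝ} (hε' : 0 < ε') (hle : ε' ≤ ε)
    (hεT : ε ≤ T) (x : E) :
    (∫ s in Set.Ioo ε' T, heatExtensionGrad u s x) - ∫ s in Set.Ioo ε T, heatExtensionGrad u s x =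
      ∫ s in Set.Ioo ε' ε, heatExtensionGrad u s x := by
  have hi : ∀ {a b : ℝ}, 0 < a → a ≤ b → IntervalIntegrable (fun s => heatExtensionGrad u s x) volume a b := by
    intro a b ha hab
    rw [intervalIntegrable_iff_integrableOn_Ioo_of_le hab]
    exact integrableOn_heatExtensionGrad_time hfw ha hab x
  have hsplit := intervalIntegral.integral_add_adjacent_intervals (hi hε' hle) (hi (hε'.trans_le hle) hεT)
  rw [intervalIntegral.integral_of_le hle, intervalIntegral.integral_of_le hεT,
    intervalIntegral.integral_of_le (hle.trans hεT), integral_Ioc_eq_integral_Ioo,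
    integral_Ioc_eq_integral_Ioo, integral_Ioc_eq_integral_Ioo] at hsplit
  rw [← hsplit]
  abel

/-- **The `L²`-Cauchy estimate for the truncated potentials** (the near-field part of
Koch–Tataru's `∂ᵢΔ⁻¹u`): for `0 < ε' ≤ ε ≤ 1` with `ε/2 ≤ ρ²` and `v ∈ E`,
`‖⟪∫_{ε'}^1 ∇e^{sΔ}u - ∫_ε^1 ∇e^{sΔ}u, v⟫‖_{L²(B(x₀,ρ))} ≤ 2 ‖v‖ S(ε/2)`, where
`S(a) = (∫∫_{(0,a)×B(x₀,2ρ)} |e^{tΔ}u|²)^{1/2} + C √a ρ^{d/2-1} γ^{1/2}` (testing the pairing identity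
with `g = 1_B ⟪·, v⟫` and the small-time estimate). [folklore] -/
theorem lintegral_ball_inner_sub_sq_rpow_le {C Cs : ℝ}
    (hC : ∀ {u : E → ℝ} {K : ℕ}, (Integrable fun w => ((1 + ‖w‖) ^ K)⁻¹ * u w) → eCarlesonNorm u < ∞ →
      ∀ {t : ℝ}, 0 < t → ∀ y : E, ‖heatExtensionGrad u t y‖ ≤ C * Real.sqrt (eCarlesonNorm u).toReal / t)
    (hCs : ∀ {u g : E → ℝ} {x₀ : E} {ρ a : ℝ},
      AEStronglyMeasurable u volume → Integrable g → MemLp g 2 volume → 0 < ρ →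
      (∀ z, z ∉ ball x₀ ρ → g z = 0) → 0 < a → a ≤ ρ ^ 2 →
      ∫⁻ p in Set.Ioo (0 : ℝ) a ×ˢ (Set.univ : Set E),
          ‖heatExtension u p.1 p.2‖ₑ * ‖heatExtensionGrad g p.1 p.2‖ₑ ≤
        ((∫⁻ p in Set.Ioo (0 : ℝ) a ×ˢ ball x₀ (2 * ρ), ‖heatExtension u p.1 p.2‖ₑ ^ 2) ^ (1 / 2 : ℝ) +
          ENNReal.ofReal (Cs * Real.sqrt a * Real.sqrt (ρ ^ Module.finrank ℝ E) / ρ) *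
            eCarlesonNorm u ^ (1 / 2 : ℝ)) *
          (∫⁻ z, ‖g z‖ₑ ^ 2) ^ (1 / 2 : ℝ))
    {u : E → ℝ} {K : ℕ} (hfw : Integrable fun w => ((1 + ‖w‖) ^ K)⁻¹ * u w) (hγ : eCarlesonNorm u < ∞)
    {x₀ : E} {ρ : ℝ} (hρ : 0 < ρ) {ε' ε : ℝ} (hε' : 0 < ε') (hle : ε' ≤ ε) (hε1 : ε ≤ 1)
    (hερ : ε / 2 ≤ ρ ^ 2) (v : E) :
    (∫⁻ x in ball x₀ ρ, ‖⟪(∫ s in Set.Ioo ε' 1, heatExtensionGrad u s x) -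
        ∫ s in Set.Ioo ε 1, heatExtensionGrad u s x, v⟫‖ₑ ^ 2) ^ (1 / 2 : ℝ) ≤
      2 * ‖v‖ₑ * ((∫⁻ p in Set.Ioo (0 : ℝ) (ε / 2) ×ˢ ball x₀ (2 * ρ), ‖heatExtension u p.1 p.2‖ₑ ^ 2) ^ (1 / 2 : ℝ) +
        ENNReal.ofReal (Cs * Real.sqrt (ε / 2) * Real.sqrt (ρ ^ Module.finrank ℝ E) / ρ) *
          eCarlesonNorm u ^ (1 / 2 : ℝ)) := by
  have hu : AEStronglyMeasurable u volume := aestronglyMeasurable_of_growth hfw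
  have hε : 0 < ε := hε'.trans_le hle
  set S : ℝ≥0∞ := (∫⁻ p in Set.Ioo (0 : ℝ) (ε / 2) ×ˢ ball x₀ (2 * ρ), ‖heatExtension u p.1 p.2‖ₑ ^ 2) ^ (1 / 2 : ℝ) +
    ENNReal.ofReal (Cs * Real.sqrt (ε / 2) * Real.sqrt (ρ ^ Module.finrank ℝ E) / ρ) *
      eCarlesonNorm u ^ (1 / 2 : ℝ) with hS
  -- the difference as one integral
  set D : E → E := fun x => ∫ s in Set.Ioo ε' ε, heatExtensionGrad u s x with hD
  have hDeq : ∀ x, (∫ s in Set.Ioo ε' 1, heatExtensionGrad u s x) - ∫ s in Set.Ioo ε 1, heatExtensionGrad u s x = D x :=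
    fun x => setIntegral_Ioo_sub_setIntegral_Ioo hfw hε' hle hε1 x
  simp_rw [hDeq]
  -- the test function
  set g : E → ℝ := (ball x₀ ρ).indicator fun x => ⟪D x, v⟫ with hg
  have hDm : StronglyMeasurable D := stronglyMeasurable_setIntegral_heatExtensionGrad hu _
  have hgm : AEStronglyMeasurable g volume :=
    ((hDm.measurable.inner measurable_const).indicator measurableSet_ball).aestronglyMeasurable
  set M₀ : ℝ := C * Real.sqrt (eCarlesonNorm u).toReal / ε' * (ε - ε') with hM₀
  have hDb : ∀ x, ‖D x‖ ≤ M₀ := fun x => norm_setIntegral_heatExtensionGrad_le hC hfw hγ hε' hle x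
  have hM₀0 : 0 ≤ M₀ := (norm_nonneg _).trans (hDb x₀)
  have hgM : ∀ z, |g z| ≤ M₀ * ‖v‖ := by
    intro z
    rw [hg]
    by_cases hz : z ∈ ball x₀ ρ
    · rw [Set.indicator_of_mem hz, ← Real.norm_eq_abs]
      exact (norm_inner_le_norm _ _).trans (mul_le_mul_of_nonneg_right (hDb z) (norm_nonneg _))
    · rw [Set.indicator_of_notMem hz, abs_zero]; positivity
  have hgs : ∀ z, z ∉ ball x₀ ρ → g z = 0 := fun z hz => by rw [hg, Set.indicator_of_notMem hz]
  have hgi : Integrable g := by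
    rw [hg, integrable_indicator_iff measurableSet_ball]
    refine Measure.integrableOn_of_bounded measure_ball_lt_top.ne
      (hDm.measurable.inner measurable_const).aestronglyMeasurable ?_ (M := M₀ * ‖v‖)
    exact Eventually.of_forall fun z => (norm_inner_le_norm _ _).trans
      (mul_le_mul_of_nonneg_right (hDb z) (norm_nonneg _))
  have hg2 : MemLp g 2 volume := memLp_two_of_support hgi hgM hgs
  -- the pairing identity with `T = ε`
  have hDI := integral_mul_inner_setIntegral_heatExtensionGrad_eq hfw hgi hρ hgM hgs hε' hle v
  -- its left-hand side is `∫ g²`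
  have hlhs : ∫ x, g x * ⟪D x, v⟫ = ∫ x, ‖g x‖ ^ 2 := by
    refine integral_congr_ae (Eventually.of_forall fun x => ?_)
    rw [hg]
    show (ball x₀ ρ).indicator (fun x => ⟪D x, v⟫) x * ⟪D x, v⟫ = ‖(ball x₀ ρ).indicator (fun x => ⟪D x, v⟫) x‖ ^ 2
    by_cases hx : x ∈ ball x₀ ρ
    · rw [Set.indicator_of_mem hx, Real.norm_eq_abs, sq_abs, sq]
    · simp only [Set.indicator_of_notMem hx, zero_mul, norm_zero]; ring
  set N : ℝ≥0∞ := (∫⁻ z, ‖g z‖ₑ ^ 2) ^ (1 / 2 : ℝ) with hN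
  have hN2 : ∫⁻ z, ‖g z‖ₑ ^ 2 = N ^ 2 := by
    rw [hN, ← ENNReal.rpow_natCast, ← ENNReal.rpow_mul]; norm_num
  have hNfin : N < ∞ := by
    rw [hN]
    refine ENNReal.rpow_lt_top_of_nonneg (by norm_num) (lt_top_iff_ne_top.mp ?_)
    exact (lintegral_enorm_sq_le_of_support hgM hgs).trans_lt
      (ENNReal.mul_lt_top ENNReal.ofReal_lt_top measure_ball_lt_top)
  -- `N² = ofReal (∫ g ⟪D, v⟫)`
  have hsq_int : Integrable fun x => ‖g x‖ ^ 2 := (memLp_two_iff_integrable_sq_norm hgi.1).mp hg2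
  have hN2' : ENNReal.ofReal (∫ x, g x * ⟪D x, v⟫) = N ^ 2 := by
    rw [hlhs, ← hN2, ofReal_integral_eq_lintegral_ofReal hsq_int (Eventually.of_forall fun x => sq_nonneg _)]
    refine lintegral_congr fun x => ?_
    rw [← ofReal_norm, ENNReal.ofReal_pow (norm_nonneg _)]
  -- the target lintegral is the same `N²`
  have htarget : ∫⁻ x in ball x₀ ρ, ‖⟪D x, v⟫‖ₑ ^ 2 = N ^ 2 := by
    rw [← hN2, hg, ← lintegral_indicator measurableSet_ball]
    refine lintegral_congr fun x => ?_
    by_cases hx : x ∈ ball x₀ ρ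
    · simp only [Set.indicator_of_mem hx]
    · simp only [Set.indicator_of_notMem hx, enorm_zero, ne_eq, OfNat.ofNat_ne_zero, not_false_eq_true,
        zero_pow]
  rw [htarget, show (N ^ 2) ^ (1 / 2 : ℝ) = N by
    rw [← ENNReal.rpow_natCast, ← ENNReal.rpow_mul]; norm_num]
  -- bound the right-hand side of the pairing identity
  have hrhs : N ^ 2 ≤ 2 * ‖v‖ₑ * S * N := by
    rw [← hN2', hDI]
    have hslab := integrable_heatExtension_mul_inner_slab hfw hgi hρ hgM hgs (a := ε' / 2) (b := ε / 2)
      (half_pos hε') (by linarith) v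
    calc ENNReal.ofReal (-2 * ∫ p in Set.Ioo (ε' / 2) (ε / 2) ×ˢ (Set.univ : Set E),
          heatExtension u p.1 p.2 * ⟪heatExtensionGrad g p.1 p.2, v⟫)
        ≤ ‖-2 * ∫ p in Set.Ioo (ε' / 2) (ε / 2) ×ˢ (Set.univ : Set E),
          heatExtension u p.1 p.2 * ⟪heatExtensionGrad g p.1 p.2, v⟫‖ₑ := by
          rw [Real.enorm_eq_ofReal_abs]; exact ENNReal.ofReal_le_ofReal (le_abs_self _)
      _ = 2 * ‖∫ p in Set.Ioo (ε' / 2) (ε / 2) ×ˢ (Set.univ : Set E),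
          heatExtension u p.1 p.2 * ⟪heatExtensionGrad g p.1 p.2, v⟫‖ₑ := by
          rw [enorm_mul, enorm_neg, show ‖(2 : ℝ)‖ₑ = 2 from by
            rw [Real.enorm_eq_ofReal (by norm_num), ENNReal.ofReal_ofNat]]
      _ ≤ 2 * ∫⁻ p in Set.Ioo (ε' / 2) (ε / 2) ×ˢ (Set.univ : Set E),
          ‖heatExtension u p.1 p.2 * ⟪heatExtensionGrad g p.1 p.2, v⟫‖ₑ := by
          gcongr
          exact enorm_integral_le_lintegral_enorm _
      _ ≤ 2 * ∫⁻ p in Set.Ioo (0 : ℝ) (ε / 2) ×ˢ (Set.univ : Set E),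
          ‖heatExtension u p.1 p.2‖ₑ * ‖heatExtensionGrad g p.1 p.2‖ₑ * ‖v‖ₑ := by
          gcongr 2 * ?_
          refine (lintegral_mono_set (Set.prod_mono (Set.Ioo_subset_Ioo (by linarith) le_rfl) subset_rfl)).trans
            (lintegral_mono fun p => ?_)
          rw [enorm_mul, mul_assoc]
          gcongr
          exact enorm_inner_le _ _
      _ = 2 * ‖v‖ₑ * ∫⁻ p in Set.Ioo (0 : ℝ) (ε / 2) ×ˢ (Set.univ : Set E),
          ‖heatExtension u p.1 p.2‖ₑ * ‖heatExtensionGrad g p.1 p.2‖ₑ := by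
          have hm : Measurable fun p : ℝ × E => ‖heatExtension u p.1 p.2‖ₑ * ‖heatExtensionGrad g p.1 p.2‖ₑ :=
            (measurable_heatExtension hu).enorm.mul (measurable_heatExtensionGrad hgi.1).enorm
          rw [lintegral_mul_const _ hm]
          ring
      _ ≤ 2 * ‖v‖ₑ * (S * N) := by
          gcongr
          exact hCs hu hgi hg2 hρ hgs (half_pos hε) hερ
      _ = _ := by ring
  -- cancel one factor of `N`
  by_cases hN0 : N = 0
  · rw [hN0]; exact zero_le
  · rw [sq] at hrhs
    exact (ENNReal.mul_le_mul_iff_left hN0 hNfin.ne).mp hrhs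

/-- Monotonicity of the small-time bound `S(a)` in `a`. [folklore] -/
theorem smallTimeBound_mono (u : E → ℝ) (x₀ : E) {ρ Cs : ℝ} (hρ : 0 < ρ) (hCs : 0 ≤ Cs) {a a' : ℝ}
    (haa' : a ≤ a') :
    (∫⁻ p in Set.Ioo (0 : ℝ) a ×ˢ ball x₀ (2 * ρ), ‖heatExtension u p.1 p.2‖ₑ ^ 2) ^ (1 / 2 : ℝ) +
        ENNReal.ofReal (Cs * Real.sqrt a * Real.sqrt (ρ ^ Module.finrank ℝ E) / ρ) * eCarlesonNorm u ^ (1 / 2 : ℝ) ≤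
      (∫⁻ p in Set.Ioo (0 : ℝ) a' ×ˢ ball x₀ (2 * ρ), ‖heatExtension u p.1 p.2‖ₑ ^ 2) ^ (1 / 2 : ℝ) +
        ENNReal.ofReal (Cs * Real.sqrt a' * Real.sqrt (ρ ^ Module.finrank ℝ E) / ρ) * eCarlesonNorm u ^ (1 / 2 : ℝ) := by
  gcongr ?_ ^ _ + ENNReal.ofReal (Cs * ?_ * _ / ρ) * _
  · exact lintegral_mono_set (Set.prod_mono (Set.Ioo_subset_Ioo le_rfl haa') subset_rfl)
  · exact Real.sqrt_le_sqrt haa'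

/-- **The small-time bound tends to zero**: along `aₙ = (n+2)⁻¹/2`,
`S(aₙ) = (∫∫_{(0,aₙ)×B(x₀,2ρ)} |e^{tΔ}u|²)^{1/2} + C √aₙ ρ^{d/2-1} γ^{1/2} → 0` (absolute continuity of
the finite Carleson box integral, `ρ ≥ 1`). [folklore] -/
theorem tendsto_smallTimeBound {u : E → ℝ} (hu : AEStronglyMeasurable u volume) (hγ : eCarlesonNorm u < ∞)
    (x₀ : E) {ρ : ℝ} (hρ : 1 ≤ ρ) (Cs : ℝ) :
    Tendsto (fun n : ℕ =>
      (∫⁻ p in Set.Ioo (0 : ℝ) (((n : ℝ) + 2)⁻¹ / 2) ×ˢ ball x₀ (2 * ρ), ‖heatExtension u p.1 p.2‖ₑ ^ 2) ^ (1 / 2 : ℝ) +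
        ENNReal.ofReal (Cs * Real.sqrt (((n : ℝ) + 2)⁻¹ / 2) * Real.sqrt (ρ ^ Module.finrank ℝ E) / ρ) *
          eCarlesonNorm u ^ (1 / 2 : ℝ)) atTop (𝓝 0) := by
  have hρ0 : 0 < ρ := by linarith
  set F : ℝ × E → ℝ≥0∞ := fun p => ‖heatExtension u p.1 p.2‖ₑ ^ 2 with hF
  have hFm : Measurable F := (measurable_heatExtension hu).enorm.pow_const 2
  set c : ℕ → ℝ := fun n => (((n : ℝ) + 2)⁻¹ / 2) with hc
  have hc0 : ∀ n, 0 < c n := fun n => by positivity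
  have hc_anti : Antitone c := by
    intro n m hnm
    simp only [hc]
    gcongr
  have hc_tendsto : Tendsto c atTop (𝓝 0) := by
    have h1 : Tendsto (fun n : ℕ => ((n : ℝ) + 2)⁻¹) atTop (𝓝 0) := by
      have := tendsto_one_div_add_atTop_nhds_zero_nat (𝕜 := ℝ)
      have h2 : Tendsto (fun n : ℕ => (1 : ℝ) / (((n + 1 : ℕ) : ℝ) + 1)) atTop (𝓝 0) :=
        this.comp (tendsto_add_atTop_nat 1)
      refine h2.congr fun n => ?_
      push_cast
      rw [one_div]
      ring
    simpa using h1.div_const 2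
  -- the tent term as a measure of decreasing sets
  set s : ℕ → Set (ℝ × E) := fun n => Set.Ioo (0 : ℝ) (c n) ×ˢ ball x₀ (2 * ρ) with hs
  have hsm : ∀ n, MeasurableSet (s n) := fun n => measurableSet_Ioo.prod measurableSet_ball
  have hs_anti : Antitone s := fun n m hnm =>
    Set.prod_mono (Set.Ioo_subset_Ioo le_rfl (hc_anti hnm)) subset_rfl
  have hs_inter : (⋂ n, s n) = ∅ := by
    ext p
    simp only [Set.mem_iInter, Set.mem_empty_iff_false, iff_false]
    intro hp
    have hp1 : ∀ n, p.1 < c n := fun n => (hp n).1.2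
    have hpos : 0 < p.1 := (hp 0).1.1
    have := (tendsto_order.1 hc_tendsto).2 p.1 hpos
    obtain ⟨n, hn⟩ := this.exists
    exact absurd (hp1 n) (not_lt.mpr hn.le)
  set μ : Measure (ℝ × E) := (volume : Measure (ℝ × E)).withDensity F with hμ
  have hT : ∀ n, ∫⁻ p in s n, F p = μ (s n) := fun n => (withDensity_apply F (hsm n)).symm
  have hfin : μ (s 0) ≠ ∞ := by
    rw [← hT 0]
    refine (lt_of_le_of_lt (lintegral_prod_ball_le_eCarlesonNorm u x₀ (by positivity : (0 : ℝ) < 2 * ρ) ?_)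
      (ENNReal.mul_lt_top hγ ENNReal.ofReal_lt_top)).ne
    intro t ht
    refine ⟨ht.1, lt_of_lt_of_le ht.2 ?_⟩
    simp only [hc]
    norm_num
    nlinarith
  have htent : Tendsto (fun n => (∫⁻ p in s n, F p) ^ (1 / 2 : ℝ)) atTop (𝓝 0) := by
    have h1 : Tendsto (fun n => μ (s n)) atTop (𝓝 0) := by
      have := tendsto_measure_iInter_atTop (μ := μ) (fun n => (hsm n).nullMeasurableSet) hs_anti ⟨0, hfin⟩
      rwa [hs_inter, measure_empty] at this
    simp_rw [hT]
    have h2 := (ENNReal.continuous_rpow_const (y := (1 / 2 : ℝ))).tendsto 0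
    rw [ENNReal.zero_rpow_of_pos (by norm_num)] at h2
    exact h2.comp h1
  have hsecond : Tendsto (fun n => ENNReal.ofReal (Cs * Real.sqrt (c n) * Real.sqrt (ρ ^ Module.finrank ℝ E) / ρ) *
      eCarlesonNorm u ^ (1 / 2 : ℝ)) atTop (𝓝 0) := by
    have h1 : Tendsto (fun n => Cs * Real.sqrt (c n) * Real.sqrt (ρ ^ Module.finrank ℝ E) / ρ) atTop (𝓝 0) := by
      have hs : Tendsto (fun n => Real.sqrt (c n)) atTop (𝓝 0) := by
        have := (Real.continuous_sqrt.tendsto 0).comp hc_tendsto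
        rwa [Function.comp_def, Real.sqrt_zero] at this
      have := ((hs.const_mul Cs).mul_const (Real.sqrt (ρ ^ Module.finrank ℝ E))).div_const ρ
      simpa using this
    have h2 : Tendsto (fun n => ENNReal.ofReal (Cs * Real.sqrt (c n) * Real.sqrt (ρ ^ Module.finrank ℝ E) / ρ))
        atTop (𝓝 0) := by
      have := ENNReal.tendsto_ofReal h1
      rwa [ENNReal.ofReal_zero] at this
    have h3 := ENNReal.Tendsto.mul_const h2 (Or.inr (ENNReal.rpow_ne_top_of_nonneg (by norm_num) hγ.ne))
      (b := eCarlesonNorm u ^ (1 / 2 : ℝ))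
    rwa [zero_mul] at h3
  have := htent.add hsecond
  rwa [add_zero] at this

omit [FiniteDimensional ℝ E] [MeasurableSpace E] [BorelSpace E] in
/-- Expansion in an orthonormal basis as a sum of functions. [folklore] -/
theorem eq_sum_inner_smul_basis {ι : Type*} [Fintype ι] (b : OrthonormalBasis ι ℝ E) (D : E → E) :
    D = ∑ i, fun x => ⟪D x, b i⟫ • b i := by
  funext x
  rw [Finset.sum_apply]
  conv_lhs => rw [← b.sum_repr' (D x)]
  refine Finset.sum_congr rfl fun i _ => ?_
  rw [real_inner_comm]

omit [MeasurableSpace E] [BorelSpace E] in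
/-- `2^j 2^{-N} ≥ 1` for `N ≤ j`, in `ℝ≥0∞`. [folklore] -/
theorem one_le_two_pow_mul_inv_two_pow {N j : ℕ} (h : N ≤ j) : (1 : ℝ≥0∞) ≤ 2 ^ j * (2⁻¹) ^ N := by
  obtain ⟨k, rfl⟩ := Nat.exists_eq_add_of_le h
  rw [pow_add, mul_assoc, mul_comm ((2 : ℝ≥0∞) ^ k), ← mul_assoc, ← mul_pow,
    ENNReal.mul_inv_cancel two_ne_zero ENNReal.ofNat_ne_top, one_pow, one_mul]
  exact one_le_pow₀ (by norm_num)

/-- **The near-field potential as an `L²_loc` limit** (Koch–Tataru's `∂ᵢΔ⁻¹u`, small times):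
there are `εₙ ↓ 0` and a strongly measurable, locally integrable `Φ₀ : E → E` with
`∫_{εₙ}^1 ∇e^{sΔ}u ds → Φ₀` in `L²(B(0, 2ʲ))` for every `j` (the truncated potentials are
`L²`-Cauchy on balls by `lintegral_ball_inner_sub_sq_rpow_le`; a diagonal choice of `εₙ` makes the
Cauchy bounds summable on every ball, whence a.e. convergence and, by Fatou, convergence in
`L²`). [folklore] -/
theorem exists_nearField {u : E → ℝ} {K : ℕ}
    (hfw : Integrable fun w => ((1 + ‖w‖) ^ K)⁻¹ * u w) (hγ : eCarlesonNorm u < ∞) :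
    ∃ (εs : ℕ → ℝ) (Φ₀ : E → E), (∀ n, 0 < εs n) ∧ (∀ n, εs n ≤ 1) ∧ Antitone εs ∧
      Tendsto εs atTop (𝓝 0) ∧ StronglyMeasurable Φ₀ ∧ LocallyIntegrable Φ₀ ∧
      ∀ j : ℕ, Tendsto (fun n => eLpNorm (fun x => (∫ s in Set.Ioo (εs n) 1, heatExtensionGrad u s x) - Φ₀ x) 2
        (volume.restrict (ball (0 : E) (2 ^ j)))) atTop (𝓝 0) := by
  have hu : AEStronglyMeasurable u volume := aestronglyMeasurable_of_growth hfw
  obtain ⟨C, hC0, hC⟩ := exists_norm_heatExtensionGrad_le (E := E)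
  obtain ⟨Cs, hCs0, hCs⟩ := exists_lintegral_small_time_le (E := E)
  set d : ℕ := Module.finrank ℝ E with hd
  set b := stdOrthonormalBasis ℝ E with hb
  -- the explicit sequence of small times and the bound `S`
  set c : ℕ → ℝ := fun n => ((n : ℝ) + 2)⁻¹ with hc
  have hc0 : ∀ n, 0 < c n := fun n => by positivity
  have hc1 : ∀ n, c n ≤ 1 := fun n => by
    simp only [hc]
    rw [inv_le_one_iff₀]
    right; linarith [n.cast_nonneg (α := ℝ)]
  have hc_anti : Antitone c := fun n m hnm => by simp only [hc]; gcongr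
  set S : ℕ → ℝ → ℝ≥0∞ := fun j a =>
    (∫⁻ p in Set.Ioo (0 : ℝ) a ×ˢ ball (0 : E) (2 * 2 ^ j), ‖heatExtension u p.1 p.2‖ₑ ^ 2) ^ (1 / 2 : ℝ) +
      ENNReal.ofReal (Cs * Real.sqrt a * Real.sqrt ((2 ^ j) ^ d) / 2 ^ j) * eCarlesonNorm u ^ (1 / 2 : ℝ) with hS
  have hS_mono : ∀ j {a a' : ℝ}, a ≤ a' → S j a ≤ S j a' := fun j a a' h =>
    smallTimeBound_mono u 0 (by positivity) hCs0 h
  have hS_tendsto : ∀ j, Tendsto (fun n => S j (c n / 2)) atTop (𝓝 0) := fun j =>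
    tendsto_smallTimeBound hu hγ 0 (one_le_pow₀ (by norm_num)) Cs
  have hS_fin : ∀ j, S j (c 0 / 2) < ∞ := by
    intro j
    simp only [hS]
    refine ENNReal.add_lt_top.mpr ⟨?_, ENNReal.mul_lt_top ENNReal.ofReal_lt_top
      (ENNReal.rpow_lt_top_of_nonneg (by norm_num) hγ.ne)⟩
    refine ENNReal.rpow_lt_top_of_nonneg (by norm_num) (lt_top_iff_ne_top.mp ?_)
    refine lt_of_le_of_lt (lintegral_prod_ball_le_eCarlesonNorm u 0 (by positivity : (0 : ℝ) < 2 * 2 ^ j) ?_)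
      (ENNReal.mul_lt_top hγ ENNReal.ofReal_lt_top)
    intro t ht
    refine ⟨ht.1, lt_of_lt_of_le ht.2 ?_⟩
    simp only [hc]
    have : (1 : ℝ) ≤ 2 ^ j := one_le_pow₀ (by norm_num)
    norm_num
    nlinarith
  -- thresholds
  have hchoice : ∀ N : ℕ, ∃ n : ℕ, ∀ j ∈ Finset.range (N + 1), S j (c n / 2) ≤ (2⁻¹ : ℝ≥0∞) ^ N := by
    intro N
    have hpos : (0 : ℝ≥0∞) < (2⁻¹ : ℝ≥0∞) ^ N := ENNReal.pow_pos (by norm_num) N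
    have h : ∀ j ∈ Finset.range (N + 1), ∀ᶠ n in atTop, S j (c n / 2) ≤ (2⁻¹ : ℝ≥0∞) ^ N :=
      fun j _ => (hS_tendsto j).eventually (Iic_mem_nhds hpos)
    exact ((Finset.range (N + 1)).eventually_all.mpr h).exists
  choose nth hnth using hchoice
  set m : ℕ → ℕ := fun N => N + ∑ k ∈ Finset.range (N + 1), nth k with hm
  have hm_mono : Monotone m := by
    intro N N' h
    simp only [hm]
    gcongr
  have hm_ge : ∀ N, nth N ≤ m N := fun N => by
    simp only [hm]
    have : nth N ≤ ∑ k ∈ Finset.range (N + 1), nth k :=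
      Finset.single_le_sum (fun k _ => Nat.zero_le _) (Finset.self_mem_range_succ N)
    omega
  have hm_geN : ∀ N, N ≤ m N := fun N => Nat.le_add_right _ _
  set εs : ℕ → ℝ := fun N => c (m N) with hεs
  have hεs0 : ∀ n, 0 < εs n := fun n => hc0 _
  have hεs1 : ∀ n, εs n ≤ 1 := fun n => hc1 _
  have hεs_anti : Antitone εs := fun n n' h => hc_anti (hm_mono h)
  have hεs_tendsto : Tendsto εs atTop (𝓝 0) := by
    have hct : Tendsto c atTop (𝓝 0) := by
      have := tendsto_one_div_add_atTop_nhds_zero_nat (𝕜 := ℝ)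
      have h2 : Tendsto (fun n : ℕ => (1 : ℝ) / (((n + 1 : ℕ) : ℝ) + 1)) atTop (𝓝 0) :=
        this.comp (tendsto_add_atTop_nat 1)
      refine h2.congr fun n => ?_
      simp only [hc]
      push_cast
      rw [one_div]
      ring
    exact hct.comp (tendsto_atTop_mono hm_geN tendsto_id)
  -- the key threshold bound, uniform in `j`
  set R : ℕ → ℕ → ℝ≥0∞ := fun j N => (S j (c 0 / 2) * 2 ^ j + 1) * (2⁻¹ : ℝ≥0∞) ^ N with hR
  have hR : ∀ j N, S j (εs N / 2) ≤ R j N := by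
    intro j N
    by_cases hjN : j ≤ N
    · have h1 : S j (εs N / 2) ≤ S j (c (nth N) / 2) := hS_mono j (by
        show c (m N) / 2 ≤ c (nth N) / 2
        linarith [hc_anti (hm_ge N)])
      refine (h1.trans (hnth N j (Finset.mem_range.mpr (Nat.lt_succ_of_le hjN)))).trans ?_
      simp only [hR]
      calc (2⁻¹ : ℝ≥0∞) ^ N = 1 * (2⁻¹ : ℝ≥0∞) ^ N := (one_mul _).symm
        _ ≤ (S j (c 0 / 2) * 2 ^ j + 1) * (2⁻¹ : ℝ≥0∞) ^ N := by gcongr; exact le_add_self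
    · have h1 : S j (εs N / 2) ≤ S j (c 0 / 2) := hS_mono j (by
        show c (m N) / 2 ≤ c 0 / 2
        have h : c (m N) ≤ c 0 := hc_anti (Nat.zero_le (m N))
        exact div_le_div_of_nonneg_right h (by norm_num))
      refine h1.trans ?_
      simp only [hR]
      calc S j (c 0 / 2) = S j (c 0 / 2) * 1 := (mul_one _).symm
        _ ≤ S j (c 0 / 2) * (2 ^ j * (2⁻¹ : ℝ≥0∞) ^ N) := by
            gcongr; exact one_le_two_pow_mul_inv_two_pow (le_of_lt (not_le.mp hjN))
        _ = S j (c 0 / 2) * 2 ^ j * (2⁻¹ : ℝ≥0∞) ^ N := by ring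
        _ ≤ _ := by gcongr; exact le_self_add
  -- the truncated potentials
  set f : ℕ → E → E := fun n x => ∫ s in Set.Ioo (εs n) 1, heatExtensionGrad u s x with hf
  have hf_meas : ∀ n, StronglyMeasurable (f n) := fun n => stronglyMeasurable_setIntegral_heatExtensionGrad hu _
  -- the Cauchy estimate on `B(0, 2^j)`
  have hcauchy : ∀ j N n n', N ≤ n → N ≤ n' →
      eLpNorm (f n - f n') 2 (volume.restrict (ball (0 : E) (2 ^ j))) ≤ 2 * d * R j N := by
    -- first the ordered case
    have hord : ∀ j N n n', N ≤ n → n ≤ n' →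
        eLpNorm (f n' - f n) 2 (volume.restrict (ball (0 : E) (2 ^ j))) ≤ 2 * d * R j N := by
      intro j N n n' hNn hnn'
      set D : E → E := f n' - f n with hD
      have hDm : AEStronglyMeasurable D (volume.restrict (ball (0 : E) (2 ^ j))) :=
        ((hf_meas n').sub (hf_meas n)).aestronglyMeasurable
      have hcomp : ∀ i, eLpNorm (fun x => ⟪D x, b i⟫ • b i) 2 (volume.restrict (ball (0 : E) (2 ^ j))) ≤
          2 * S j (εs N / 2) := by
        intro i
        have h1 : eLpNorm (fun x => ⟪D x, b i⟫ • b i) 2 (volume.restrict (ball (0 : E) (2 ^ j))) =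
            eLpNorm (fun x => ⟪D x, b i⟫) 2 (volume.restrict (ball (0 : E) (2 ^ j))) := by
          refine eLpNorm_congr_norm_ae (Eventually.of_forall fun x => ?_)
          simp only [norm_smul, b.orthonormal.1 i, mul_one]
        rw [h1, eLpNorm_two_eq_rpow]
        have h2 := lintegral_ball_inner_sub_sq_rpow_le hC hCs hfw hγ (x₀ := (0 : E)) (ρ := 2 ^ j) (by positivity)
          (hεs0 n') (hεs_anti hnn') (hεs1 n) ?_ (b i)
        · have h3 : ∀ x, ⟪D x, b i⟫ = ⟪(∫ s in Set.Ioo (εs n') 1, heatExtensionGrad u s x) -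
              ∫ s in Set.Ioo (εs n) 1, heatExtensionGrad u s x, b i⟫ := fun x => rfl
          simp_rw [h3]
          refine h2.trans ?_
          rw [show ‖b i‖ₑ = 1 by rw [← ofReal_norm, b.orthonormal.1 i, ENNReal.ofReal_one], mul_one]
          gcongr
          have h4 : S j (εs n / 2) ≤ S j (εs N / 2) := hS_mono j (by
            show c (m n) / 2 ≤ c (m N) / 2
            linarith [hc_anti (hm_mono hNn)])
          refine le_trans (le_of_eq ?_) h4
          simp only [hS, ← hd]
        · have : (1 : ℝ) ≤ (2 ^ j) ^ 2 := one_le_pow₀ (one_le_pow₀ (by norm_num))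
          linarith [hεs1 n]
      calc eLpNorm D 2 (volume.restrict (ball (0 : E) (2 ^ j)))
          = eLpNorm (∑ i, fun x => ⟪D x, b i⟫ • b i) 2 (volume.restrict (ball (0 : E) (2 ^ j))) := by
            rw [← eq_sum_inner_smul_basis b D]
        _ ≤ ∑ i, eLpNorm (fun x => ⟪D x, b i⟫ • b i) 2 (volume.restrict (ball (0 : E) (2 ^ j))) :=
            eLpNorm_sum_le (fun i _ => ((hDm.inner_const (c := b i)).smul_const _ : _)) one_le_two
        _ ≤ ∑ _i : Fin (Module.finrank ℝ E), 2 * S j (εs N / 2) := Finset.sum_le_sum fun i _ => hcomp i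
        _ = d * (2 * S j (εs N / 2)) := by rw [Finset.sum_const, Finset.card_fin, nsmul_eq_mul, hd]
        _ ≤ d * (2 * R j N) := by gcongr; exact hR j N
        _ = 2 * d * R j N := by ring
    intro j N n n' hn hn'
    rcases le_total n n' with h | h
    · rw [eLpNorm_sub_comm]; exact hord j N n n' hn h
    · exact hord j N n' n hn' h
  -- summable bounds and a.e. convergence on each ball
  have h2d : (2 * (d : ℝ≥0∞) + 1) ≠ ∞ :=
    ENNReal.add_ne_top.mpr ⟨ENNReal.mul_ne_top ENNReal.ofNat_ne_top (ENNReal.natCast_ne_top d), ENNReal.one_ne_top⟩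
  set B : ℕ → ℕ → ℝ≥0∞ := fun j N => (2 * d + 1) * R j N + (2⁻¹ : ℝ≥0∞) ^ N with hB
  have hRfin : ∀ j N, R j N ≠ ∞ := by
    intro j N
    show (S j (c 0 / 2) * 2 ^ j + 1) * (2⁻¹ : ℝ≥0∞) ^ N ≠ ∞
    refine ENNReal.mul_ne_top ?_ (ENNReal.pow_ne_top (ENNReal.inv_ne_top.mpr two_ne_zero))
    exact ENNReal.add_ne_top.mpr ⟨ENNReal.mul_ne_top (hS_fin j).ne (ENNReal.pow_ne_top ENNReal.ofNat_ne_top),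
      ENNReal.one_ne_top⟩
  have hcauchy' : ∀ j N n n', N ≤ n → N ≤ n' →
      eLpNorm (f n - f n') 2 (volume.restrict (ball (0 : E) (2 ^ j))) < B j N := by
    intro j N n n' hn hn'
    refine lt_of_le_of_lt (hcauchy j N n n' hn hn') ?_
    show 2 * (d : ℝ≥0∞) * R j N < (2 * d + 1) * R j N + (2⁻¹ : ℝ≥0∞) ^ N
    calc 2 * (d : ℝ≥0∞) * R j N ≤ (2 * d + 1) * R j N := by gcongr; exact le_self_add
      _ < (2 * d + 1) * R j N + (2⁻¹ : ℝ≥0∞) ^ N := by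
          refine ENNReal.lt_add_right ?_ (ENNReal.pow_pos (by norm_num) N).ne'
          exact ENNReal.mul_ne_top h2d (hRfin j N)
  have hBsum : ∀ j, ∑' N, B j N ≠ ∞ := by
    intro j
    show ∑' N, ((2 * (d : ℝ≥0∞) + 1) * ((S j (c 0 / 2) * 2 ^ j + 1) * (2⁻¹ : ℝ≥0∞) ^ N) + (2⁻¹ : ℝ≥0∞) ^ N) ≠ ∞
    have h1 : ∀ N, (2 * (d : ℝ≥0∞) + 1) * ((S j (c 0 / 2) * 2 ^ j + 1) * (2⁻¹ : ℝ≥0∞) ^ N) + (2⁻¹ : ℝ≥0∞) ^ N =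
        ((2 * (d : ℝ≥0∞) + 1) * (S j (c 0 / 2) * 2 ^ j + 1) + 1) * (2⁻¹ : ℝ≥0∞) ^ N := fun N => by ring
    simp_rw [h1]
    rw [ENNReal.tsum_mul_left, ENNReal.tsum_geometric, ENNReal.one_sub_inv_two, inv_inv]
    refine ENNReal.mul_ne_top (ENNReal.add_ne_top.mpr ⟨ENNReal.mul_ne_top h2d ?_, ENNReal.one_ne_top⟩)
      ENNReal.ofNat_ne_top
    exact ENNReal.add_ne_top.mpr ⟨ENNReal.mul_ne_top (hS_fin j).ne (ENNReal.pow_ne_top ENNReal.ofNat_ne_top),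
      ENNReal.one_ne_top⟩
  have hae_ball : ∀ j, ∀ᵐ x ∂(volume.restrict (ball (0 : E) (2 ^ j))), ∃ l : E, Tendsto (fun n => f n x) atTop (𝓝 l) :=
    fun j => MeasureTheory.Lp.ae_tendsto_of_cauchy_eLpNorm (fun n => (hf_meas n).aestronglyMeasurable) one_le_two (hBsum j)
      (hcauchy' j)
  have hae : ∀ᵐ x ∂(volume : Measure E), ∃ l : E, Tendsto (fun n => f n x) atTop (𝓝 l) := by
    have hunion : (⋃ j : ℕ, ball (0 : E) (2 ^ j)) = Set.univ := by
      refine Set.eq_univ_of_forall fun x => ?_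
      obtain ⟨j, hj⟩ := pow_unbounded_of_one_lt ‖x‖ (by norm_num : (1 : ℝ) < 2)
      exact Set.mem_iUnion.mpr ⟨j, mem_ball_zero_iff.mpr hj⟩
    have := (ae_restrict_iUnion_iff (μ := (volume : Measure E)) (fun j : ℕ => ball (0 : E) (2 ^ j))
      (p := fun x => ∃ l : E, Tendsto (fun n => f n x) atTop (𝓝 l))).mpr hae_ball
    rwa [hunion, Measure.restrict_univ] at this
  obtain ⟨Φ₀, hΦ₀m, hΦ₀⟩ := exists_stronglyMeasurable_limit_of_tendsto_ae (fun n => (hf_meas n).aestronglyMeasurable) hae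
  -- `L²` convergence on balls, by Fatou
  have hL2 : ∀ j n, eLpNorm (f n - Φ₀) 2 (volume.restrict (ball (0 : E) (2 ^ j))) ≤ B j n := by
    intro j n
    have hlim : ∀ᵐ x ∂(volume.restrict (ball (0 : E) (2 ^ j))),
        Tendsto (fun n' => (f n - f n') x) atTop (𝓝 ((f n - Φ₀) x)) := by
      refine (ae_restrict_of_ae hΦ₀).mono fun x hx => ?_
      simp only [Pi.sub_apply]
      exact tendsto_const_nhds.sub hx
    have h := MeasureTheory.Lp.eLpNorm_lim_le_liminf_eLpNorm (p := (2 : ℝ≥0∞))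
      (fun n' => ((hf_meas n).sub (hf_meas n')).aestronglyMeasurable) (f n - Φ₀) hlim
    refine h.trans ?_
    refine Filter.liminf_le_of_frequently_le' (Filter.Eventually.frequently ?_)
    exact (eventually_ge_atTop n).mono fun n' hn' => (hcauchy' j n n n' le_rfl hn').le
  have hB_tendsto : ∀ j, Tendsto (fun n => B j n) atTop (𝓝 0) := by
    intro j
    exact ENNReal.tendsto_atTop_zero_of_tsum_ne_top (hBsum j)
  refine ⟨εs, Φ₀, hεs0, hεs1, hεs_anti, hεs_tendsto, hΦ₀m, ?_, fun j => ?_⟩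
  · -- local integrability: `L²` on every ball
    have hball : ∀ j, IntegrableOn Φ₀ (ball (0 : E) (2 ^ j)) := by
      intro j
      haveI : IsFiniteMeasure (volume.restrict (ball (0 : E) (2 ^ j))) := ⟨by
        rw [Measure.restrict_apply_univ]; exact measure_ball_lt_top⟩
      have h2 : MemLp Φ₀ 2 (volume.restrict (ball (0 : E) (2 ^ j))) := by
        refine ⟨hΦ₀m.aestronglyMeasurable, ?_⟩
        have h3 : eLpNorm Φ₀ 2 (volume.restrict (ball (0 : E) (2 ^ j))) ≤
            eLpNorm (f 0 - Φ₀) 2 (volume.restrict (ball (0 : E) (2 ^ j))) + eLpNorm (f 0) 2 (volume.restrict (ball (0 : E) (2 ^ j))) := by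
          have := eLpNorm_sub_le (((hf_meas 0).aestronglyMeasurable)) (((hf_meas 0).sub hΦ₀m).aestronglyMeasurable)
            (μ := volume.restrict (ball (0 : E) (2 ^ j))) (p := 2) one_le_two
          have e : f 0 - (f 0 - Φ₀) = Φ₀ := by abel
          rw [e] at this
          refine this.trans (le_of_eq ?_)
          rw [add_comm]
        refine lt_of_le_of_lt h3 (ENNReal.add_lt_top.mpr ⟨lt_of_le_of_lt (hL2 j 0) ?_, ?_⟩)
        · show (2 * (d : ℝ≥0∞) + 1) * R j 0 + (2⁻¹ : ℝ≥0∞) ^ 0 < ∞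
          exact (ENNReal.add_ne_top.mpr ⟨ENNReal.mul_ne_top h2d (hRfin j 0),
            ENNReal.pow_ne_top (ENNReal.inv_ne_top.mpr two_ne_zero)⟩).lt_top
        · -- `f 0` is bounded on the ball
          exact (MemLp.of_bound (hf_meas 0).aestronglyMeasurable _ (Eventually.of_forall fun x =>
            norm_setIntegral_heatExtensionGrad_le hC hfw hγ (hεs0 0) (hεs1 0) x)).eLpNorm_lt_top
      exact h2.integrable one_le_two
    intro x
    obtain ⟨j, hj⟩ := pow_unbounded_of_one_lt ‖x‖ (by norm_num : (1 : ℝ) < 2)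
    exact ⟨ball 0 (2 ^ j), isOpen_ball.mem_nhds (mem_ball_zero_iff.mpr hj), hball j⟩
  · have := hB_tendsto j
    refine tendsto_of_tendsto_of_tendsto_of_le_of_le tendsto_const_nhds this (fun n => zero_le) (fun n => ?_)
    exact hL2 j n

/-- **Integrability of the pairing integrand down to `t = 0`** for a test function `g ∈ L²`
supported in a ball: `(t, y) ↦ e^{tΔ}u (y) ⟪∇e^{tΔ}g (y), v⟫` is integrable on `(0, T) × E`
(small-time estimate near `0`, slab integrability away from `0`). [folklore] -/
theorem integrableOn_heatExtension_mul_inner_Ioo {u g : E → ℝ} {K : ℕ}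
    (hfw : Integrable fun w => ((1 + ‖w‖) ^ K)⁻¹ * u w) (hγ : eCarlesonNorm u < ∞) (hgi : Integrable g)
    (hg2 : MemLp g 2 volume) {x₀ : E} {ρ M : ℝ} (hρ : 0 < ρ) (hgM : ∀ z, |g z| ≤ M)
    (hgs : ∀ z, z ∉ ball x₀ ρ → g z = 0) {T : ℝ} (hT : 0 < T) (v : E) :
    IntegrableOn (fun p : ℝ × E => heatExtension u p.1 p.2 * ⟪heatExtensionGrad g p.1 p.2, v⟫)
      (Set.Ioo (0 : ℝ) T ×ˢ (Set.univ : Set E)) := by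
  have hu : AEStronglyMeasurable u volume := aestronglyMeasurable_of_growth hfw
  obtain ⟨Cs, hCs0, hCs⟩ := exists_lintegral_small_time_le (E := E)
  set a₀ : ℝ := min T (ρ ^ 2) with ha₀
  have ha₀0 : 0 < a₀ := lt_min hT (by positivity)
  have hmeas : AEStronglyMeasurable
      (fun p : ℝ × E => heatExtension u p.1 p.2 * ⟪heatExtensionGrad g p.1 p.2, v⟫) volume :=
    ((measurable_heatExtension hu).mul
      ((measurable_heatExtensionGrad hgi.1).inner measurable_const)).aestronglyMeasurable
  -- near `0`
  have hnear : IntegrableOn (fun p : ℝ × E => heatExtension u p.1 p.2 * ⟪heatExtensionGrad g p.1 p.2, v⟫)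
      (Set.Ioo (0 : ℝ) a₀ ×ˢ (Set.univ : Set E)) := by
    refine ⟨hmeas.restrict, ?_⟩
    rw [hasFiniteIntegral_iff_enorm]
    have h1 := hCs hu hgi hg2 hρ hgs ha₀0 (min_le_right _ _)
    have hfinS : ((∫⁻ p in Set.Ioo (0 : ℝ) a₀ ×ˢ ball x₀ (2 * ρ), ‖heatExtension u p.1 p.2‖ₑ ^ 2) ^ (1 / 2 : ℝ) +
        ENNReal.ofReal (Cs * Real.sqrt a₀ * Real.sqrt (ρ ^ Module.finrank ℝ E) / ρ) *
          eCarlesonNorm u ^ (1 / 2 : ℝ)) < ∞ := by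
      refine ENNReal.add_lt_top.mpr ⟨?_, ENNReal.mul_lt_top ENNReal.ofReal_lt_top
        (ENNReal.rpow_lt_top_of_nonneg (by norm_num) hγ.ne)⟩
      refine ENNReal.rpow_lt_top_of_nonneg (by norm_num) (lt_top_iff_ne_top.mp ?_)
      refine lt_of_le_of_lt (lintegral_prod_ball_le_eCarlesonNorm u x₀ (by positivity : (0 : ℝ) < 2 * ρ) ?_)
        (ENNReal.mul_lt_top hγ ENNReal.ofReal_lt_top)
      intro t ht
      exact ⟨ht.1, lt_of_lt_of_le ht.2 ((min_le_right _ _).trans (by nlinarith))⟩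
    have hg2fin : (∫⁻ z, ‖g z‖ₑ ^ 2) ^ (1 / 2 : ℝ) < ∞ := by
      refine ENNReal.rpow_lt_top_of_nonneg (by norm_num) (lt_top_iff_ne_top.mp ?_)
      exact (lintegral_enorm_sq_le_of_support hgM hgs).trans_lt
        (ENNReal.mul_lt_top ENNReal.ofReal_lt_top measure_ball_lt_top)
    calc ∫⁻ p in Set.Ioo (0 : ℝ) a₀ ×ˢ (Set.univ : Set E), ‖heatExtension u p.1 p.2 * ⟪heatExtensionGrad g p.1 p.2, v⟫‖ₑ
        ≤ ∫⁻ p in Set.Ioo (0 : ℝ) a₀ ×ˢ (Set.univ : Set E),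
            ‖heatExtension u p.1 p.2‖ₑ * ‖heatExtensionGrad g p.1 p.2‖ₑ * ‖v‖ₑ := by
          refine lintegral_mono fun p => ?_
          rw [enorm_mul, mul_assoc]
          gcongr
          exact enorm_inner_le _ _
      _ = (∫⁻ p in Set.Ioo (0 : ℝ) a₀ ×ˢ (Set.univ : Set E),
            ‖heatExtension u p.1 p.2‖ₑ * ‖heatExtensionGrad g p.1 p.2‖ₑ) * ‖v‖ₑ := by
          have hm : Measurable fun p : ℝ × E => ‖heatExtension u p.1 p.2‖ₑ * ‖heatExtensionGrad g p.1 p.2‖ₑ :=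
            (measurable_heatExtension hu).enorm.mul (measurable_heatExtensionGrad hgi.1).enorm
          rw [lintegral_mul_const _ hm]
      _ < ∞ := ENNReal.mul_lt_top (lt_of_le_of_lt h1 (ENNReal.mul_lt_top hfinS hg2fin)) enorm_lt_top
  -- away from `0`
  by_cases hTa : a₀ < T
  · have hfar : IntegrableOn (fun p : ℝ × E => heatExtension u p.1 p.2 * ⟪heatExtensionGrad g p.1 p.2, v⟫)
        (Set.Ioo (a₀ / 2) T ×ˢ (Set.univ : Set E)) := by
      rw [IntegrableOn, volume_restrict_prod_univ]
      exact integrable_heatExtension_mul_inner_slab hfw hgi hρ hgM hgs (half_pos ha₀0) (by linarith) v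
    refine (hnear.union hfar).mono_set ?_
    intro p hp
    by_cases h : p.1 < a₀
    · exact Or.inl ⟨⟨hp.1.1, h⟩, hp.2⟩
    · exact Or.inr ⟨⟨by linarith [not_lt.mp h], hp.1.2⟩, hp.2⟩
  · have hEq : a₀ = T := le_antisymm (min_le_left _ _) (not_lt.mp hTa)
    rw [← hEq]
    exact hnear

/-- **The pairing identity for the near-field potential**: if `∫_{εₙ}^1 ∇e^{sΔ}u ds → Φ₀` in
`L²_loc` with `εₙ ↓ 0`, then for every bounded `g` supported in a ball and `v ∈ E`,
`∫ g ⟪Φ₀, v⟫ = -2 ∫∫_{(0,1/2) × E} e^{tΔ}u ⟪∇e^{tΔ}g, v⟫`. [folklore] -/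
theorem integral_mul_inner_nearField_eq {u : E → ℝ} {K : ℕ}
    (hfw : Integrable fun w => ((1 + ‖w‖) ^ K)⁻¹ * u w) (hγ : eCarlesonNorm u < ∞)
    {εs : ℕ → ℝ} {Φ₀ : E → E} (hεs0 : ∀ n, 0 < εs n) (hεs1 : ∀ n, εs n ≤ 1) (hεs_anti : Antitone εs)
    (hεs_tendsto : Tendsto εs atTop (𝓝 0)) (hΦ₀m : StronglyMeasurable Φ₀) (hΦ₀i : LocallyIntegrable Φ₀)
    (hL2 : ∀ j : ℕ, Tendsto (fun n => eLpNorm (fun x => (∫ s in Set.Ioo (εs n) 1, heatExtensionGrad u s x) - Φ₀ x) 2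
        (volume.restrict (ball (0 : E) (2 ^ j)))) atTop (𝓝 0))
    {g : E → ℝ} (hgi : Integrable g) (hg2 : MemLp g 2 volume) {x₀ : E} {ρ M : ℝ} (hρ : 0 < ρ)
    (hgM : ∀ z, |g z| ≤ M) (hgs : ∀ z, z ∉ ball x₀ ρ → g z = 0) (v : E) :
    ∫ x, g x * ⟪Φ₀ x, v⟫ =
      -2 * ∫ p in Set.Ioo (0 : ℝ) (1 / 2) ×ˢ (Set.univ : Set E),
        heatExtension u p.1 p.2 * ⟪heatExtensionGrad g p.1 p.2, v⟫ := by
  have hu : AEStronglyMeasurable u volume := aestronglyMeasurable_of_growth hfw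
  have hM : 0 ≤ M := (abs_nonneg _).trans (hgM x₀)
  obtain ⟨C, hC0, hC⟩ := exists_norm_heatExtensionGrad_le (E := E)
  -- a dyadic ball containing the support
  obtain ⟨j, hj⟩ := pow_unbounded_of_one_lt (‖x₀‖ + ρ) (by norm_num : (1 : ℝ) < 2)
  have hsub : ball x₀ ρ ⊆ ball (0 : E) (2 ^ j) := by
    intro z hz
    rw [mem_ball_zero_iff]
    have h1 : ‖z - x₀‖ < ρ := mem_ball_iff_norm.mp hz
    have h2 := norm_le_norm_add_norm_sub' z x₀
    linarith
  set Bj : Set E := ball (0 : E) (2 ^ j) with hBj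
  set μj : Measure E := volume.restrict Bj with hμj
  haveI : IsFiniteMeasure μj := ⟨by rw [hμj, Measure.restrict_apply_univ]; exact measure_ball_lt_top⟩
  set f : ℕ → E → E := fun n x => ∫ s in Set.Ioo (εs n) 1, heatExtensionGrad u s x with hf
  have hf_meas : ∀ n, StronglyMeasurable (f n) := fun n => stronglyMeasurable_setIntegral_heatExtensionGrad hu _
  have hfb : ∀ n x, ‖f n x‖ ≤ C * Real.sqrt (eCarlesonNorm u).toReal / εs n * (1 - εs n) := fun n x =>
    norm_setIntegral_heatExtensionGrad_le hC hfw hγ (hεs0 n) (hεs1 n) x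
  -- integrability of the two pairings
  have hgm : AEStronglyMeasurable g volume := hgi.1
  have hint_f : ∀ n, Integrable fun x => g x * ⟪f n x, v⟫ := by
    intro n
    refine (hgi.norm.const_mul (C * Real.sqrt (eCarlesonNorm u).toReal / εs n * (1 - εs n) * ‖v‖)).mono'
      (hgm.mul ((hf_meas n).measurable.inner measurable_const).aestronglyMeasurable)
      (Eventually.of_forall fun x => ?_)
    rw [norm_mul]
    calc ‖g x‖ * ‖⟪f n x, v⟫‖ ≤ ‖g x‖ * (C * Real.sqrt (eCarlesonNorm u).toReal / εs n * (1 - εs n) * ‖v‖) := by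
          gcongr
          exact (norm_inner_le_norm _ _).trans (mul_le_mul_of_nonneg_right (hfb n x) (norm_nonneg _))
      _ = _ := by ring
  have hΦj : IntegrableOn Φ₀ Bj := (hΦ₀i.integrableOn_isCompact (isCompact_closedBall (0 : E) (2 ^ j))).mono_set
    ball_subset_closedBall
  have hint_Φ : Integrable fun x => g x * ⟪Φ₀ x, v⟫ := by
    have h1 : Integrable fun x => Bj.indicator (fun x => ‖Φ₀ x‖) x * (M * ‖v‖) :=
      ((integrable_indicator_iff measurableSet_ball).mpr hΦj.norm).mul_const _
    refine h1.mono' (hgm.mul (hΦ₀m.measurable.inner measurable_const).aestronglyMeasurable)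
      (Eventually.of_forall fun x => ?_)
    by_cases hx : x ∈ ball x₀ ρ
    · rw [Set.indicator_of_mem (hsub hx), norm_mul, Real.norm_eq_abs]
      calc |g x| * ‖⟪Φ₀ x, v⟫‖ ≤ M * (‖Φ₀ x‖ * ‖v‖) := mul_le_mul (hgM x) (norm_inner_le_norm _ _) (norm_nonneg _) hM
        _ = ‖Φ₀ x‖ * (M * ‖v‖) := by ring
    · rw [hgs x hx, zero_mul, norm_zero]
      exact mul_nonneg (Set.indicator_nonneg (fun _ _ => norm_nonneg _) _) (by positivity)
  -- Step 1: the identity for each `n`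
  have hn : ∀ n, ∫ x, g x * ⟪f n x, v⟫ = -2 * ∫ p in Set.Ioo (εs n / 2) (1 / 2) ×ˢ (Set.univ : Set E),
      heatExtension u p.1 p.2 * ⟪heatExtensionGrad g p.1 p.2, v⟫ :=
    fun n => integral_mul_inner_setIntegral_heatExtensionGrad_eq hfw hgi hρ hgM hgs (hεs0 n) (hεs1 n) v
  -- Step 2: the left-hand sides converge
  have hlhs : Tendsto (fun n => ∫ x, g x * ⟪f n x, v⟫) atTop (𝓝 (∫ x, g x * ⟪Φ₀ x, v⟫)) := by
    rw [tendsto_iff_edist_tendsto_0]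
    have hbound : ∀ n, edist (∫ x, g x * ⟪f n x, v⟫) (∫ x, g x * ⟪Φ₀ x, v⟫) ≤
        ENNReal.ofReal M * ‖v‖ₑ * (eLpNorm (f n - Φ₀) 2 μj * μj Set.univ ^ (1 / 2 : ℝ)) := by
      intro n
      rw [edist_eq_enorm_sub, ← integral_sub (hint_f n) hint_Φ]
      have e1 : (fun x => g x * ⟪f n x, v⟫ - g x * ⟪Φ₀ x, v⟫) = fun x => g x * ⟪(f n - Φ₀) x, v⟫ := by
        funext x
        rw [Pi.sub_apply, inner_sub_left, mul_sub]
      rw [e1]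
      calc ‖∫ x, g x * ⟪(f n - Φ₀) x, v⟫‖ₑ ≤ ∫⁻ x, ‖g x * ⟪(f n - Φ₀) x, v⟫‖ₑ := enorm_integral_le_lintegral_enorm _
        _ ≤ ∫⁻ x, Bj.indicator (fun x => ENNReal.ofReal M * ‖v‖ₑ * ‖(f n - Φ₀) x‖ₑ) x := by
            refine lintegral_mono fun x => ?_
            by_cases hx : x ∈ ball x₀ ρ
            · rw [Set.indicator_of_mem (hsub hx), enorm_mul]
              calc ‖g x‖ₑ * ‖⟪(f n - Φ₀) x, v⟫‖ₑ ≤ ENNReal.ofReal M * (‖(f n - Φ₀) x‖ₑ * ‖v‖ₑ) := by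
                    gcongr
                    · rw [Real.enorm_eq_ofReal_abs]; exact ENNReal.ofReal_le_ofReal (hgM x)
                    · exact enorm_inner_le _ _
                _ = _ := by ring
            · rw [hgs x hx, zero_mul, enorm_zero]; exact zero_le
        _ = ENNReal.ofReal M * ‖v‖ₑ * ∫⁻ x in Bj, ‖(f n - Φ₀) x‖ₑ := by
            rw [lintegral_indicator measurableSet_ball, lintegral_const_mul]
            exact ((hf_meas n).sub hΦ₀m).measurable.enorm
        _ = ENNReal.ofReal M * ‖v‖ₑ * eLpNorm (f n - Φ₀) 1 μj := by rw [eLpNorm_one_eq_lintegral_enorm]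
        _ ≤ ENNReal.ofReal M * ‖v‖ₑ * (eLpNorm (f n - Φ₀) 2 μj * μj Set.univ ^ (1 / 2 : ℝ)) := by
            gcongr
            have := eLpNorm_le_eLpNorm_mul_rpow_measure_univ (p := 1) (q := 2) (μ := μj) one_le_two
              (((hf_meas n).sub hΦ₀m).aestronglyMeasurable)
            norm_num at this
            exact this
    have hlim : Tendsto (fun n => ENNReal.ofReal M * ‖v‖ₑ * (eLpNorm (f n - Φ₀) 2 μj * μj Set.univ ^ (1 / 2 : ℝ)))
        atTop (𝓝 0) := by
      have h1 : Tendsto (fun n => eLpNorm (f n - Φ₀) 2 μj * μj Set.univ ^ (1 / 2 : ℝ)) atTop (𝓝 0) := by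
        have := ENNReal.Tendsto.mul_const (hL2 j) (Or.inr (ENNReal.rpow_ne_top_of_nonneg (by norm_num)
          (measure_ne_top μj _))) (b := μj Set.univ ^ (1 / 2 : ℝ))
        rwa [zero_mul] at this
      have h2 := ENNReal.Tendsto.const_mul h1 (Or.inr (ENNReal.mul_ne_top ENNReal.ofReal_ne_top enorm_ne_top))
        (a := ENNReal.ofReal M * ‖v‖ₑ)
      rwa [mul_zero] at h2
    exact tendsto_of_tendsto_of_tendsto_of_le_of_le tendsto_const_nhds hlim (fun n => zero_le) hbound
  -- Step 3: the right-hand sides converge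
  have hrhs : Tendsto (fun n => -2 * ∫ p in Set.Ioo (εs n / 2) (1 / 2) ×ˢ (Set.univ : Set E),
      heatExtension u p.1 p.2 * ⟪heatExtensionGrad g p.1 p.2, v⟫) atTop
      (𝓝 (-2 * ∫ p in Set.Ioo (0 : ℝ) (1 / 2) ×ˢ (Set.univ : Set E),
        heatExtension u p.1 p.2 * ⟪heatExtensionGrad g p.1 p.2, v⟫)) := by
    refine Tendsto.const_mul (-2) ?_
    have hunion : (⋃ n, Set.Ioo (εs n / 2) (1 / 2) ×ˢ (Set.univ : Set E)) = Set.Ioo (0 : ℝ) (1 / 2) ×ˢ Set.univ := by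
      ext p
      simp only [Set.mem_iUnion, Set.mem_prod, Set.mem_Ioo, Set.mem_univ, and_true]
      constructor
      · rintro ⟨n, h1, h2⟩
        exact ⟨lt_trans (by linarith [hεs0 n]) h1, h2⟩
      · rintro ⟨h1, h2⟩
        have := (tendsto_order.1 hεs_tendsto).2 (2 * p.1) (by linarith)
        obtain ⟨n, hn⟩ := this.exists
        exact ⟨n, by linarith, h2⟩
    have h := tendsto_setIntegral_of_monotone (μ := (volume : Measure (ℝ × E)))
      (f := fun p : ℝ × E => heatExtension u p.1 p.2 * ⟪heatExtensionGrad g p.1 p.2, v⟫)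
      (s := fun n => Set.Ioo (εs n / 2) (1 / 2) ×ˢ (Set.univ : Set E))
      (fun n => measurableSet_Ioo.prod MeasurableSet.univ) ?_ ?_
    · rwa [hunion] at h
    · intro n n' hnn'
      exact Set.prod_mono (Set.Ioo_subset_Ioo (by linarith [hεs_anti hnn']) le_rfl) subset_rfl
    · rw [hunion]
      exact integrableOn_heatExtension_mul_inner_Ioo hfw hγ hgi hg2 hρ hgM hgs (by norm_num) v
  -- conclude
  have heq : (fun n => ∫ x, g x * ⟪f n x, v⟫) = fun n => -2 * ∫ p in Set.Ioo (εs n / 2) (1 / 2) ×ˢ (Set.univ : Set E),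
      heatExtension u p.1 p.2 * ⟪heatExtensionGrad g p.1 p.2, v⟫ := funext hn
  rw [heq] at hlhs
  exact tendsto_nhds_unique hlhs hrhs

end NearField

/-! ## The far field `∫_1^∞ (∇e^{sΔ}u (x) - ∇e^{sΔ}u (0)) ds` -/

section FarField

variable {E : Type*} [NormedAddCommGroup E] [InnerProductSpace ℝ E] [FiniteDimensional ℝ E]
  [MeasurableSpace E] [BorelSpace E]

omit [MeasurableSpace E] [BorelSpace E] in
/-- `1/(s √s) = s^{-3/2}` for `s > 0`. [folklore] -/
theorem one_div_mul_sqrt_eq_rpow {s : ℝ} (hs : 0 < s) : 1 / (s * Real.sqrt s) = s ^ (-(3 / 2 : ℝ)) := by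
  rw [Real.rpow_neg hs.le, Real.sqrt_eq_rpow, ← Real.rpow_one s, ← Real.rpow_mul hs.le, one_mul,
    ← Real.rpow_add hs, Real.rpow_one, one_div]
  norm_num

/-- `∫_1^∞ s^{-3/2} ds = 2`. [folklore] -/
theorem integral_Ioi_one_rpow_neg_three_halves : ∫ s in Set.Ioi (1 : ℝ), s ^ (-(3 / 2 : ℝ)) = 2 := by
  rw [integral_Ioi_rpow_of_lt (by norm_num) one_pos]
  norm_num

/-- **The far-field integrand is integrable in time**: for `x ∈ E`,
`s ↦ ∇e^{sΔ}u (x) - ∇e^{sΔ}u (0)` is integrable on `(1, ∞)`, with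
`‖∫_1^∞ (∇e^{sΔ}u (x) - ∇e^{sΔ}u (0)) ds‖ ≤ 2 C γ^{1/2} ‖x‖`. [folklore] -/
theorem integrableOn_farField_integrand {C : ℝ}
    (hC : ∀ {u : E → ℝ} {K : ℕ}, (Integrable fun w => ((1 + ‖w‖) ^ K)⁻¹ * u w) → eCarlesonNorm u < ∞ →
      ∀ {s : ℝ}, 0 < s → ∀ x x' : E, ‖heatExtensionGrad u s x - heatExtensionGrad u s x'‖ ≤
        C * Real.sqrt (eCarlesonNorm u).toReal * ‖x - x'‖ / (s * Real.sqrt s))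
    {u : E → ℝ} {K : ℕ} (hfw : Integrable fun w => ((1 + ‖w‖) ^ K)⁻¹ * u w) (hγ : eCarlesonNorm u < ∞)
    (x : E) :
    IntegrableOn (fun s => heatExtensionGrad u s x - heatExtensionGrad u s 0) (Set.Ioi (1 : ℝ)) ∧
      ‖∫ s in Set.Ioi (1 : ℝ), (heatExtensionGrad u s x - heatExtensionGrad u s 0)‖ ≤
        2 * C * Real.sqrt (eCarlesonNorm u).toReal * ‖x‖ := by
  have hu : AEStronglyMeasurable u volume := aestronglyMeasurable_of_growth hfw
  set A : ℝ := C * Real.sqrt (eCarlesonNorm u).toReal * ‖x‖ with hA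
  have hbound : ∀ s ∈ Set.Ioi (1 : ℝ), ‖heatExtensionGrad u s x - heatExtensionGrad u s 0‖ ≤ A * s ^ (-(3 / 2 : ℝ)) := by
    intro s hs
    have hs0 : 0 < s := lt_trans one_pos hs
    have h := hC hfw hγ hs0 x 0
    rw [sub_zero] at h
    rw [← one_div_mul_sqrt_eq_rpow hs0, hA]
    calc ‖heatExtensionGrad u s x - heatExtensionGrad u s 0‖
        ≤ C * Real.sqrt (eCarlesonNorm u).toReal * ‖x‖ / (s * Real.sqrt s) := h
      _ = C * Real.sqrt (eCarlesonNorm u).toReal * ‖x‖ * (1 / (s * Real.sqrt s)) := by ring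
  have hA0 : 0 ≤ A := by
    have h := hbound 2 (by norm_num : (1 : ℝ) < 2)
    have h2 : (0 : ℝ) < (2 : ℝ) ^ (-(3 / 2 : ℝ)) := Real.rpow_pos_of_pos two_pos _
    nlinarith [norm_nonneg (heatExtensionGrad u 2 x - heatExtensionGrad u 2 0)]
  have hmeas : AEStronglyMeasurable (fun s => heatExtensionGrad u s x - heatExtensionGrad u s 0)
      (volume.restrict (Set.Ioi (1 : ℝ))) :=
    (((measurable_heatExtensionGrad hu).comp (measurable_id.prodMk measurable_const)).sub
      ((measurable_heatExtensionGrad hu).comp (measurable_id.prodMk measurable_const))).aestronglyMeasurable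
  have hint_rpow : IntegrableOn (fun s : ℝ => A * s ^ (-(3 / 2 : ℝ))) (Set.Ioi (1 : ℝ)) :=
    (integrableOn_Ioi_rpow_of_lt (by norm_num) one_pos).const_mul A
  have hint : IntegrableOn (fun s => heatExtensionGrad u s x - heatExtensionGrad u s 0) (Set.Ioi (1 : ℝ)) :=
    Integrable.mono' hint_rpow hmeas ((ae_restrict_mem measurableSet_Ioi).mono hbound)
  refine ⟨hint, ?_⟩
  calc ‖∫ s in Set.Ioi (1 : ℝ), (heatExtensionGrad u s x - heatExtensionGrad u s 0)‖
      ≤ ∫ s in Set.Ioi (1 : ℝ), A * s ^ (-(3 / 2 : ℝ)) :=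
        norm_integral_le_of_norm_le hint_rpow ((ae_restrict_mem measurableSet_Ioi).mono hbound)
    _ = 2 * C * Real.sqrt (eCarlesonNorm u).toReal * ‖x‖ := by
        rw [integral_const_mul, integral_Ioi_one_rpow_neg_three_halves, hA]; ring

/-- The far-field potential `x ↦ ∫_1^∞ (∇e^{sΔ}u (x) - ∇e^{sΔ}u (0)) ds` is strongly measurable. [folklore] -/
theorem stronglyMeasurable_farField {u : E → ℝ} (hu : AEStronglyMeasurable u volume) :
    StronglyMeasurable fun x : E => ∫ s in Set.Ioi (1 : ℝ), (heatExtensionGrad u s x - heatExtensionGrad u s 0) := by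
  have h1 : Measurable fun q : ℝ × E => heatExtensionGrad u q.1 q.2 - heatExtensionGrad u q.1 0 :=
    (measurable_heatExtensionGrad hu).sub ((measurable_heatExtensionGrad hu).comp (measurable_fst.prodMk measurable_const))
  exact h1.stronglyMeasurable.integral_prod_left

/-- For tempered `u`, a bounded `g` supported in a ball and `s > 0`, `x ↦ g(x) ⟪∇e^{sΔ}u (x), v⟫`
is integrable. [folklore] -/
theorem integrable_mul_inner_heatExtensionGrad {u g : E → ℝ} {K : ℕ}
    (hfw : Integrable fun w => ((1 + ‖w‖) ^ K)⁻¹ * u w) (hgi : Integrable g) {x₀ : E} {ρ : ℝ}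
    (hgs : ∀ z, z ∉ ball x₀ ρ → g z = 0) {s : ℝ} (hs : 0 < s) (v : E) :
    Integrable fun x => g x * ⟪heatExtensionGrad u s x, v⟫ := by
  have hu : AEStronglyMeasurable u volume := aestronglyMeasurable_of_growth hfw
  obtain ⟨C, hC0, hC⟩ := exists_unif_bound_heatExtensionGrad_of_growth hfw hs le_rfl
  set Bρ : ℝ := (1 + ‖x₀‖ + ρ) ^ K with hBρ
  have hmeas : Measurable fun x => heatExtensionGrad u s x :=
    (measurable_heatExtensionGrad hu).comp (measurable_const.prodMk measurable_id)
  refine (hgi.norm.const_mul (Bρ * C * ‖v‖)).mono' (hgi.1.mul (hmeas.inner measurable_const).aestronglyMeasurable)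
    (Eventually.of_forall fun x => ?_)
  rw [norm_mul, Real.norm_eq_abs, Real.norm_eq_abs]
  have h1 : ‖⟪heatExtensionGrad u s x, v⟫‖ ≤ C * (1 + ‖x‖) ^ K * ‖v‖ :=
    (norm_inner_le_norm _ _).trans (mul_le_mul_of_nonneg_right (hC s ⟨le_rfl, le_rfl⟩ x) (norm_nonneg _))
  have hgx := abs_mul_one_add_norm_pow_le_of_support hgs K x
  calc |g x| * ‖⟪heatExtensionGrad u s x, v⟫‖ ≤ |g x| * (C * (1 + ‖x‖) ^ K * ‖v‖) := by gcongr
    _ = (|g x| * (1 + ‖x‖) ^ K) * (C * ‖v‖) := by ring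
    _ ≤ (Bρ * |g x|) * (C * ‖v‖) := by gcongr
    _ = Bρ * C * ‖v‖ * |g x| := by ring

/-- **Integrability of the pairing integrand on `(a, ∞) × E`** for a mean-zero atom-like `g`
(from the total estimate). [folklore] -/
theorem integrableOn_heatExtension_mul_inner_Ioi {u g : E → ℝ} {K : ℕ}
    (hfw : Integrable fun w => ((1 + ‖w‖) ^ K)⁻¹ * u w) (hγ : eCarlesonNorm u < ∞) (hgi : Integrable g)
    {x₀ : E} {ρ M : ℝ} (hρ : 0 < ρ) (hgM : ∀ z, |g z| ≤ M) (hgs : ∀ z, z ∉ ball x₀ ρ → g z = 0)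
    (hg0 : ∫ z, g z = 0) {a : ℝ} (ha : 0 ≤ a) (v : E) :
    IntegrableOn (fun p : ℝ × E => heatExtension u p.1 p.2 * ⟪heatExtensionGrad g p.1 p.2, v⟫)
      (Set.Ioi a ×ˢ (Set.univ : Set E)) := by
  have hu : AEStronglyMeasurable u volume := aestronglyMeasurable_of_growth hfw
  obtain ⟨A₁, A₂, hA₁, hA₂, hA⟩ := exists_lintegral_two_mul_enorm_heatExtension_mul_le (E := E)
  have htot := hA hu hγ hgi hρ hgM hgs hg0
  have hmeas : AEStronglyMeasurable
      (fun p : ℝ × E => heatExtension u p.1 p.2 * ⟪heatExtensionGrad g p.1 p.2, v⟫) volume :=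
    ((measurable_heatExtension hu).mul
      ((measurable_heatExtensionGrad hgi.1).inner measurable_const)).aestronglyMeasurable
  refine ⟨hmeas.restrict, ?_⟩
  rw [hasFiniteIntegral_iff_enorm]
  have hm : Measurable fun p : ℝ × E => ‖heatExtension u p.1 p.2‖ₑ * ‖heatExtensionGrad g p.1 p.2‖ₑ :=
    (measurable_heatExtension hu).enorm.mul (measurable_heatExtensionGrad hgi.1).enorm
  calc ∫⁻ p in Set.Ioi a ×ˢ (Set.univ : Set E), ‖heatExtension u p.1 p.2 * ⟪heatExtensionGrad g p.1 p.2, v⟫‖ₑ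
      ≤ ∫⁻ p in Set.Ioi (0 : ℝ) ×ˢ (Set.univ : Set E),
          2 * (‖heatExtension u p.1 p.2‖ₑ * ‖heatExtensionGrad g p.1 p.2‖ₑ) * ‖v‖ₑ := by
        refine (lintegral_mono_set (Set.prod_mono (Set.Ioi_subset_Ioi ha) subset_rfl)).trans
          (lintegral_mono fun p => ?_)
        rw [enorm_mul, mul_assoc]
        calc ‖heatExtension u p.1 p.2‖ₑ * ‖⟪heatExtensionGrad g p.1 p.2, v⟫‖ₑ
            ≤ 1 * (‖heatExtension u p.1 p.2‖ₑ * (‖heatExtensionGrad g p.1 p.2‖ₑ * ‖v‖ₑ)) := by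
              rw [one_mul]; gcongr; exact enorm_inner_le _ _
          _ ≤ 2 * (‖heatExtension u p.1 p.2‖ₑ * (‖heatExtensionGrad g p.1 p.2‖ₑ * ‖v‖ₑ)) := by
              gcongr; exact one_le_two
          _ = _ := by ring
    _ = (∫⁻ p in Set.Ioi (0 : ℝ) ×ˢ (Set.univ : Set E),
          2 * (‖heatExtension u p.1 p.2‖ₑ * ‖heatExtensionGrad g p.1 p.2‖ₑ)) * ‖v‖ₑ := by
        rw [lintegral_mul_const _ (hm.const_mul 2)]
    _ < ∞ := ENNReal.mul_lt_top (lt_of_le_of_lt htot ENNReal.ofReal_lt_top) enorm_lt_top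

/-- Points of `E × (a, ∞)` (for the product with the restricted time measure) have time
coordinate in `(a, ∞)`. [folklore] -/
theorem ae_snd_mem_Ioi (a : ℝ) :
    ∀ᵐ p : E × ℝ ∂((volume : Measure E).prod (volume.restrict (Set.Ioi a))), p.2 ∈ Set.Ioi a := by
  have h : ((volume : Measure E).prod (volume.restrict (Set.Ioi a))) =
      ((volume : Measure E).prod volume).restrict (Set.univ ×ˢ Set.Ioi a) := by
    rw [← Measure.prod_restrict, Measure.restrict_univ]
  rw [h]
  exact (ae_restrict_mem (MeasurableSet.univ.prod measurableSet_Ioi)).mono fun p hp => hp.2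

omit [InnerProductSpace ℝ E] [FiniteDimensional ℝ E] [MeasurableSpace E] [BorelSpace E] in
/-- `|g(x)| ‖x‖ ≤ (1 + ‖x₀‖ + ρ) |g(x)|` for `g` vanishing off `B(x₀, ρ)`. [folklore] -/
theorem abs_mul_norm_le_of_support [NormedSpace ℝ E] {g : E → ℝ} {x₀ : E} {ρ : ℝ}
    (hgs : ∀ z, z ∉ ball x₀ ρ → g z = 0) (x : E) :
    |g x| * ‖x‖ ≤ (1 + ‖x₀‖ + ρ) * |g x| := by
  have h := abs_mul_one_add_norm_pow_le_of_support hgs 1 x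
  rw [pow_one, pow_one] at h
  nlinarith [abs_nonneg (g x), norm_nonneg x]

/-- **The pairing identity for the far field**: for tempered `u` with finite Carleson quantity, a
mean-zero atom-like `g` and `v ∈ E`,
`∫ g ⟪∫_1^∞ (∇e^{sΔ}u - ∇e^{sΔ}u (0)) ds, v⟫ = -2 ∫∫_{(1/2,∞) × E} e^{tΔ}u ⟪∇e^{tΔ}g, v⟫`
(Fubini, the renormalising constant drops out by `∫ g = 0`, and the finite-time pairing
identities). [folklore] -/
theorem integral_mul_inner_farField_eq {C : ℝ} (hC0 : 0 ≤ C)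
    (hC : ∀ {u : E → ℝ} {K : ℕ}, (Integrable fun w => ((1 + ‖w‖) ^ K)⁻¹ * u w) → eCarlesonNorm u < ∞ →
      ∀ {s : ℝ}, 0 < s → ∀ x x' : E, ‖heatExtensionGrad u s x - heatExtensionGrad u s x'‖ ≤
        C * Real.sqrt (eCarlesonNorm u).toReal * ‖x - x'‖ / (s * Real.sqrt s))
    {u g : E → ℝ} {K : ℕ} (hfw : Integrable fun w => ((1 + ‖w‖) ^ K)⁻¹ * u w) (hγ : eCarlesonNorm u < ∞)
    (hgi : Integrable g) {x₀ : E} {ρ M : ℝ} (hρ : 0 < ρ) (hgM : ∀ z, |g z| ≤ M)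
    (hgs : ∀ z, z ∉ ball x₀ ρ → g z = 0) (hg0 : ∫ z, g z = 0) (v : E) :
    ∫ x, g x * ⟪∫ s in Set.Ioi (1 : ℝ), (heatExtensionGrad u s x - heatExtensionGrad u s 0), v⟫ =
      -2 * ∫ p in Set.Ioi (1 / 2 : ℝ) ×ˢ (Set.univ : Set E),
        heatExtension u p.1 p.2 * ⟪heatExtensionGrad g p.1 p.2, v⟫ := by
  have hu : AEStronglyMeasurable u volume := aestronglyMeasurable_of_growth hfw
  set A₀ : ℝ := C * Real.sqrt (eCarlesonNorm u).toReal with hA₀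
  have hA₀0 : 0 ≤ A₀ := by positivity
  set W : E → ℝ → E := fun x s => heatExtensionGrad u s x - heatExtensionGrad u s 0 with hW
  have hWb : ∀ x, ∀ s ∈ Set.Ioi (1 : ℝ), ‖W x s‖ ≤ A₀ * ‖x‖ * s ^ (-(3 / 2 : ℝ)) := by
    intro x s hs
    have hs0 : 0 < s := lt_trans one_pos hs
    have h := hC hfw hγ hs0 x 0
    rw [sub_zero] at h
    rw [← one_div_mul_sqrt_eq_rpow hs0]
    calc ‖W x s‖ ≤ C * Real.sqrt (eCarlesonNorm u).toReal * ‖x‖ / (s * Real.sqrt s) := h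
      _ = A₀ * ‖x‖ * (1 / (s * Real.sqrt s)) := by rw [hA₀]; ring
  -- Step 1: Fubini in `(x, s)`
  set F : E → ℝ → ℝ := fun x s => g x * ⟪W x s, v⟫ with hF
  have hFint : Integrable (Function.uncurry F) ((volume : Measure E).prod (volume.restrict (Set.Ioi (1 : ℝ)))) := by
    have hmeas : AEStronglyMeasurable (Function.uncurry F) ((volume : Measure E).prod (volume.restrict (Set.Ioi (1 : ℝ)))) := by
      have h1 : AEStronglyMeasurable (fun p : E × ℝ => g p.1) ((volume : Measure E).prod (volume.restrict (Set.Ioi (1 : ℝ)))) :=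
        hgi.1.comp_fst
      have h2 : Measurable fun p : E × ℝ => ⟪W p.1 p.2, v⟫ := by
        have hG := measurable_heatExtensionGrad hu
        have h3 : Measurable fun p : E × ℝ => heatExtensionGrad u p.2 p.1 - heatExtensionGrad u p.2 0 :=
          (hG.comp (measurable_snd.prodMk measurable_fst)).sub (hG.comp (measurable_snd.prodMk measurable_const))
        exact h3.inner measurable_const
      exact h1.mul h2.aestronglyMeasurable
    refine Integrable.mono' ((hgi.norm.const_mul ((1 + ‖x₀‖ + ρ) * A₀ * ‖v‖)).mul_prod
      (integrableOn_Ioi_rpow_of_lt (by norm_num : (-(3 / 2 : ℝ)) < -1) one_pos)) hmeas ?_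
    refine (ae_snd_mem_Ioi (E := E) 1).mono fun p hp => ?_
    rcases p with ⟨x, s⟩
    show ‖g x * ⟪W x s, v⟫‖ ≤ (1 + ‖x₀‖ + ρ) * A₀ * ‖v‖ * ‖g x‖ * s ^ (-(3 / 2 : ℝ))
    rw [norm_mul, Real.norm_eq_abs, Real.norm_eq_abs]
    have h1 : ‖⟪W x s, v⟫‖ ≤ A₀ * ‖x‖ * s ^ (-(3 / 2 : ℝ)) * ‖v‖ :=
      (norm_inner_le_norm _ _).trans (mul_le_mul_of_nonneg_right (hWb x s hp) (norm_nonneg _))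
    have h2 := abs_mul_norm_le_of_support hgs x
    have hs0 : (0 : ℝ) ≤ s ^ (-(3 / 2 : ℝ)) := Real.rpow_nonneg (le_of_lt (lt_trans one_pos hp)) _
    calc |g x| * ‖⟪W x s, v⟫‖ ≤ |g x| * (A₀ * ‖x‖ * s ^ (-(3 / 2 : ℝ)) * ‖v‖) := by gcongr
      _ = (|g x| * ‖x‖) * (A₀ * ‖v‖ * s ^ (-(3 / 2 : ℝ))) := by ring
      _ ≤ ((1 + ‖x₀‖ + ρ) * |g x|) * (A₀ * ‖v‖ * s ^ (-(3 / 2 : ℝ))) := by gcongr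
      _ = _ := by ring
  have hswap := integral_integral_swap hFint
  have step1 : ∫ x, g x * ⟪∫ s in Set.Ioi (1 : ℝ), W x s, v⟫ = ∫ x, ∫ s in Set.Ioi (1 : ℝ), F x s := by
    refine integral_congr_ae (Eventually.of_forall fun x => ?_)
    show g x * ⟪∫ s in Set.Ioi (1 : ℝ), W x s, v⟫ = ∫ s in Set.Ioi (1 : ℝ), g x * ⟪W x s, v⟫
    rw [integral_const_mul, ← integral_real_inner_const (integrableOn_farField_integrand hC hfw hγ x).1 v]
  rw [step1, hswap]
  -- Step 2: for each `s > 1`, the constant drops out and the finite-time identities apply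
  set H : ℝ → ℝ := fun t => ∫ w, heatExtension u t w * ⟪heatExtensionGrad g t w, v⟫ with hH
  have step2 : ∫ s in Set.Ioi (1 : ℝ), ∫ x, F x s = ∫ s in Set.Ioi (1 : ℝ), -H ((1 / 2 : ℝ) * s) := by
    refine setIntegral_congr_fun measurableSet_Ioi fun s hs => ?_
    have hs0 : 0 < s := lt_trans one_pos hs
    show ∫ x, g x * ⟪heatExtensionGrad u s x - heatExtensionGrad u s 0, v⟫ = -H ((1 / 2 : ℝ) * s)
    have e1 : (fun x => g x * ⟪heatExtensionGrad u s x - heatExtensionGrad u s 0, v⟫) =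
        fun x => g x * ⟪heatExtensionGrad u s x, v⟫ - g x * ⟪heatExtensionGrad u s 0, v⟫ := by
      funext x; rw [inner_sub_left, mul_sub]
    rw [e1, integral_sub (integrable_mul_inner_heatExtensionGrad hfw hgi hgs hs0 v) (hgi.mul_const _),
      integral_mul_const, hg0, zero_mul, sub_zero,
      integral_mul_inner_heatExtensionGrad_eq_neg hfw hgi hgs hs0 v,
      integral_mul_inner_heatExtensionGrad_eq_half hfw hgi hρ hgM hgs hs0 v, hH]
    simp only [one_div, inv_mul_eq_div]
  rw [step2, integral_neg, integral_comp_mul_left_Ioi (fun t => H t) 1 (by norm_num : (0 : ℝ) < 1 / 2)]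
  -- Step 3: Fubini on the infinite slab
  have step3 : ∫ t in Set.Ioi (1 / 2 * 1 : ℝ), H t =
      ∫ p in Set.Ioi (1 / 2 : ℝ) ×ˢ (Set.univ : Set E), heatExtension u p.1 p.2 * ⟪heatExtensionGrad g p.1 p.2, v⟫ := by
    rw [mul_one, volume_restrict_prod_univ, integral_prod]
    have h := integrableOn_heatExtension_mul_inner_Ioi hfw hγ hgi hρ hgM hgs hg0 (by norm_num : (0 : ℝ) ≤ 1 / 2) v
    rwa [IntegrableOn, volume_restrict_prod_univ] at h
  rw [step3, smul_eq_mul]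
  norm_num

end FarField

/-! ## The potential `Φ` and its pairing with atoms; `BMO` of the components -/

section Potential

variable {E : Type*} [NormedAddCommGroup E] [InnerProductSpace ℝ E] [FiniteDimensional ℝ E]
  [MeasurableSpace E] [BorelSpace E]

/-- A bounded function supported in a ball against a locally integrable field: `g ⟪Φ, v⟫ ∈ L¹`. [folklore] -/
theorem integrable_mul_inner_of_locallyIntegrable {Φ : E → E} (hΦ : LocallyIntegrable Φ)
    (hΦm : StronglyMeasurable Φ) {g : E → ℝ} (hgi : Integrable g) {x₀ : E} {ρ M : ℝ}
    (hgM : ∀ z, |g z| ≤ M) (hgs : ∀ z, z ∉ ball x₀ ρ → g z = 0) (v : E) :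
    Integrable fun x => g x * ⟪Φ x, v⟫ := by
  have hM : 0 ≤ M := (abs_nonneg _).trans (hgM x₀)
  have hΦB : IntegrableOn Φ (ball x₀ ρ) :=
    (hΦ.integrableOn_isCompact (isCompact_closedBall x₀ ρ)).mono_set ball_subset_closedBall
  have h1 : Integrable fun x => (ball x₀ ρ).indicator (fun x => ‖Φ x‖) x * (M * ‖v‖) :=
    ((integrable_indicator_iff measurableSet_ball).mpr hΦB.norm).mul_const _
  refine h1.mono' (hgi.1.mul (hΦm.measurable.inner measurable_const).aestronglyMeasurable)
    (Eventually.of_forall fun x => ?_)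
  by_cases hx : x ∈ ball x₀ ρ
  · rw [Set.indicator_of_mem hx, norm_mul, Real.norm_eq_abs]
    calc |g x| * ‖⟪Φ x, v⟫‖ ≤ M * (‖Φ x‖ * ‖v‖) := mul_le_mul (hgM x) (norm_inner_le_norm _ _) (norm_nonneg _) hM
      _ = ‖Φ x‖ * (M * ‖v‖) := by ring
  · rw [hgs x hx, zero_mul, norm_zero]
    exact mul_nonneg (Set.indicator_nonneg (fun _ _ => norm_nonneg _) _) (by positivity)

/-- Splitting `(0, ∞) × E` at `t = 1/2` in a set integral. [folklore] -/
theorem setIntegral_Ioi_prod_eq_add {F : ℝ × E → ℝ}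
    (h1 : IntegrableOn F (Set.Ioo (0 : ℝ) (1 / 2) ×ˢ (Set.univ : Set E)))
    (h2 : IntegrableOn F (Set.Ioi (1 / 2 : ℝ) ×ˢ (Set.univ : Set E))) :
    ∫ p in Set.Ioi (0 : ℝ) ×ˢ (Set.univ : Set E), F p =
      (∫ p in Set.Ioo (0 : ℝ) (1 / 2) ×ˢ (Set.univ : Set E), F p) +
        ∫ p in Set.Ioi (1 / 2 : ℝ) ×ˢ (Set.univ : Set E), F p := by
  have hdisj : Disjoint (Set.Ioo (0 : ℝ) (1 / 2) ×ˢ (Set.univ : Set E)) (Set.Ioi (1 / 2 : ℝ) ×ˢ (Set.univ : Set E)) := by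
    rw [Set.disjoint_prod]
    left
    exact Set.disjoint_left.mpr fun t ht ht' => absurd ht.2 (not_lt.mpr (le_of_lt ht'))
  rw [← setIntegral_union hdisj (measurableSet_Ioi.prod MeasurableSet.univ) h1 h2]
  refine setIntegral_congr_set ?_
  -- the two sets differ by the null slice `{1/2} × E`
  refine (ae_eq_set).mpr ⟨?_, ?_⟩
  · have hsub : (Set.Ioi (0 : ℝ) ×ˢ (Set.univ : Set E)) \
        (Set.Ioo (0 : ℝ) (1 / 2) ×ˢ Set.univ ∪ Set.Ioi (1 / 2 : ℝ) ×ˢ Set.univ) ⊆ {(1 / 2 : ℝ)} ×ˢ (Set.univ : Set E) := by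
      rintro ⟨t, y⟩ ⟨⟨ht, -⟩, hnot⟩
      simp only [Set.mem_union, Set.mem_prod, Set.mem_Ioo, Set.mem_univ, and_true, Set.mem_Ioi, not_or, not_and,
        not_lt] at hnot
      refine ⟨?_, Set.mem_univ _⟩
      rw [Set.mem_singleton_iff]
      exact le_antisymm hnot.2 (hnot.1 ht)
    refine measure_mono_null hsub ?_
    rw [Measure.volume_eq_prod, Measure.prod_prod, Real.volume_singleton, zero_mul]
  · have : (Set.Ioo (0 : ℝ) (1 / 2) ×ˢ Set.univ ∪ Set.Ioi (1 / 2 : ℝ) ×ˢ Set.univ) \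
        (Set.Ioi (0 : ℝ) ×ˢ (Set.univ : Set E)) = ∅ := by
      refine Set.sdiff_eq_empty.mpr ?_
      rintro ⟨t, y⟩ h
      rcases h with ⟨ht, -⟩ | ⟨ht, -⟩
      · exact ⟨ht.1, Set.mem_univ _⟩
      · exact ⟨lt_trans (by norm_num : (0 : ℝ) < 1 / 2) ht, Set.mem_univ _⟩
    rw [this, measure_empty]

/-- **Koch–Tataru's potential** (the vector field `Φ` with `fⁱ = ⟪Φ, eᵢ⟫ = -∂ᵢΔ⁻¹u`, realised as
the `L²_loc`-limit of `-∫_ε^1 ∇e^{sΔ}u ds` minus the renormalised far field): for tempered `u` with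
finite Carleson quantity there is a strongly measurable, locally integrable `Φ : E → E` whose
pairing with every mean-zero bounded `g` supported in a ball is
`∫ g ⟪Φ, v⟫ = 2 ∫∫_{(0,∞) × E} e^{tΔ}u ⟪∇e^{tΔ}g, v⟫`. [cite: KochTataruAdvMath2001, Theorem 1] -/
theorem exists_potential {u : E → ℝ} {K : ℕ}
    (hfw : Integrable fun w => ((1 + ‖w‖) ^ K)⁻¹ * u w) (hγ : eCarlesonNorm u < ∞) :
    ∃ Φ : E → E, StronglyMeasurable Φ ∧ LocallyIntegrable Φ ∧
      ∀ {g : E → ℝ} {x₀ : E} {ρ M : ℝ}, Integrable g → 0 < ρ → (∀ z, |g z| ≤ M) →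
        (∀ z, z ∉ ball x₀ ρ → g z = 0) → (∫ z, g z = 0) → ∀ v : E,
        ∫ x, g x * ⟪Φ x, v⟫ =
          2 * ∫ p in Set.Ioi (0 : ℝ) ×ˢ (Set.univ : Set E),
            heatExtension u p.1 p.2 * ⟪heatExtensionGrad g p.1 p.2, v⟫ := by
  have hu : AEStronglyMeasurable u volume := aestronglyMeasurable_of_growth hfw
  obtain ⟨εs, Φ₀, hεs0, hεs1, hεs_anti, hεs_tendsto, hΦ₀m, hΦ₀i, hL2⟩ := exists_nearField hfw hγ
  obtain ⟨C, hC0, hC⟩ := exists_norm_heatExtensionGrad_sub_le (E := E)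
  set Ψ : E → E := fun x => ∫ s in Set.Ioi (1 : ℝ), (heatExtensionGrad u s x - heatExtensionGrad u s 0) with hΨ
  have hΨm : StronglyMeasurable Ψ := stronglyMeasurable_farField hu
  have hΨb : ∀ x, ‖Ψ x‖ ≤ 2 * C * Real.sqrt (eCarlesonNorm u).toReal * ‖x‖ := fun x =>
    (integrableOn_farField_integrand hC hfw hγ x).2
  have hΨi : LocallyIntegrable Ψ := by
    intro x
    refine ⟨ball x 1, isOpen_ball.mem_nhds (mem_ball_self one_pos), ?_⟩
    refine Measure.integrableOn_of_bounded (M := 2 * C * Real.sqrt (eCarlesonNorm u).toReal * (‖x‖ + 1))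
      measure_ball_lt_top.ne hΨm.aestronglyMeasurable ?_
    refine (ae_restrict_mem measurableSet_ball).mono fun y hy => (hΨb y).trans ?_
    gcongr
    have := norm_le_norm_add_norm_sub' y x
    have h2 : ‖y - x‖ < 1 := mem_ball_iff_norm.mp hy
    linarith
  refine ⟨fun x => -(Φ₀ x + Ψ x), (hΦ₀m.add hΨm).neg, (hΦ₀i.add hΨi).neg, ?_⟩
  intro g x₀ ρ M hgi hρ hgM hgs hg0 v
  have hg2 : MemLp g 2 volume := memLp_two_of_support hgi hgM hgs
  have hnear := integral_mul_inner_nearField_eq hfw hγ hεs0 hεs1 hεs_anti hεs_tendsto hΦ₀m hΦ₀i hL2 hgi hg2 hρ hgM hgs v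
  have hfar := integral_mul_inner_farField_eq hC0 hC hfw hγ hgi hρ hgM hgs hg0 v
  have hi1 := integrable_mul_inner_of_locallyIntegrable hΦ₀i hΦ₀m hgi hgM hgs v
  have hi2 := integrable_mul_inner_of_locallyIntegrable hΨi hΨm hgi hgM hgs v
  have e1 : (fun x => g x * ⟪-(Φ₀ x + Ψ x), v⟫) = fun x => -(g x * ⟪Φ₀ x, v⟫ + g x * ⟪Ψ x, v⟫) := by
    funext x
    rw [inner_neg_left, inner_add_left]
    ring
  rw [e1, integral_neg, integral_add hi1 hi2, hnear, hfar,
    setIntegral_Ioi_prod_eq_add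
      (integrableOn_heatExtension_mul_inner_Ioo hfw hγ hgi hg2 hρ hgM hgs (by norm_num) v)
      (integrableOn_heatExtension_mul_inner_Ioi hfw hγ hgi hρ hgM hgs hg0 (by norm_num) v)]
  ring

/-- **The duality bound for the potential**: with `A₁, A₂` the constants of the total estimate,
`|∫ g ⟪Φ, v⟫| ≤ ‖v‖ (A₁ γ + A₂ M²) ρ^d` for every mean-zero `g` with `|g| ≤ M` supported in
`B(x₀, ρ)`. [folklore] -/
theorem abs_integral_mul_inner_le {u : E → ℝ} {K : ℕ}
    (hfw : Integrable fun w => ((1 + ‖w‖) ^ K)⁻¹ * u w) (hγ : eCarlesonNorm u < ∞) {Φ : E → E}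
    (hΦ : ∀ {g : E → ℝ} {x₀ : E} {ρ M : ℝ}, Integrable g → 0 < ρ → (∀ z, |g z| ≤ M) →
        (∀ z, z ∉ ball x₀ ρ → g z = 0) → (∫ z, g z = 0) → ∀ v : E,
        ∫ x, g x * ⟪Φ x, v⟫ =
          2 * ∫ p in Set.Ioi (0 : ℝ) ×ˢ (Set.univ : Set E),
            heatExtension u p.1 p.2 * ⟪heatExtensionGrad g p.1 p.2, v⟫)
    {A₁ A₂ : ℝ} (hA₁ : 0 ≤ A₁) (hA₂ : 0 ≤ A₂)
    (hA : ∀ {u g : E → ℝ} {x₀ : E} {ρ M : ℝ},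
      AEStronglyMeasurable u volume → eCarlesonNorm u < ∞ → Integrable g → 0 < ρ → (∀ z, |g z| ≤ M) →
      (∀ z, z ∉ ball x₀ ρ → g z = 0) → (∫ z, g z = 0) →
      ∫⁻ p in Set.Ioi (0 : ℝ) ×ˢ (Set.univ : Set E),
          2 * (‖heatExtension u p.1 p.2‖ₑ * ‖heatExtensionGrad g p.1 p.2‖ₑ) ≤
        ENNReal.ofReal ((A₁ * (eCarlesonNorm u).toReal + A₂ * M ^ 2) * ρ ^ Module.finrank ℝ E))
    {g : E → ℝ} {x₀ : E} {ρ M : ℝ} (hgi : Integrable g) (hρ : 0 < ρ) (hgM : ∀ z, |g z| ≤ M)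
    (hgs : ∀ z, z ∉ ball x₀ ρ → g z = 0) (hg0 : ∫ z, g z = 0) (v : E) :
    |∫ x, g x * ⟪Φ x, v⟫| ≤
      ‖v‖ * ((A₁ * (eCarlesonNorm u).toReal + A₂ * M ^ 2) * ρ ^ Module.finrank ℝ E) := by
  have hu : AEStronglyMeasurable u volume := aestronglyMeasurable_of_growth hfw
  rw [hΦ hgi hρ hgM hgs hg0 v]
  set Q : ℝ := (A₁ * (eCarlesonNorm u).toReal + A₂ * M ^ 2) * ρ ^ Module.finrank ℝ E with hQ
  have hQ0 : 0 ≤ Q := by positivity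
  have htot := hA hu hγ hgi hρ hgM hgs hg0
  have hm : Measurable fun p : ℝ × E => ‖heatExtension u p.1 p.2‖ₑ * ‖heatExtensionGrad g p.1 p.2‖ₑ :=
    (measurable_heatExtension hu).enorm.mul (measurable_heatExtensionGrad hgi.1).enorm
  have h1 : ‖2 * ∫ p in Set.Ioi (0 : ℝ) ×ˢ (Set.univ : Set E),
      heatExtension u p.1 p.2 * ⟪heatExtensionGrad g p.1 p.2, v⟫‖ₑ ≤ ‖v‖ₑ * ENNReal.ofReal Q := by
    calc ‖2 * ∫ p in Set.Ioi (0 : ℝ) ×ˢ (Set.univ : Set E), heatExtension u p.1 p.2 * ⟪heatExtensionGrad g p.1 p.2, v⟫‖ₑ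
        = 2 * ‖∫ p in Set.Ioi (0 : ℝ) ×ˢ (Set.univ : Set E), heatExtension u p.1 p.2 * ⟪heatExtensionGrad g p.1 p.2, v⟫‖ₑ := by
          rw [enorm_mul, show ‖(2 : ℝ)‖ₑ = 2 from by rw [Real.enorm_eq_ofReal (by norm_num), ENNReal.ofReal_ofNat]]
      _ ≤ 2 * ∫⁻ p in Set.Ioi (0 : ℝ) ×ˢ (Set.univ : Set E), ‖heatExtension u p.1 p.2 * ⟪heatExtensionGrad g p.1 p.2, v⟫‖ₑ := by
          gcongr; exact enorm_integral_le_lintegral_enorm _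
      _ ≤ 2 * ∫⁻ p in Set.Ioi (0 : ℝ) ×ˢ (Set.univ : Set E),
            ‖heatExtension u p.1 p.2‖ₑ * ‖heatExtensionGrad g p.1 p.2‖ₑ * ‖v‖ₑ := by
          gcongr with p
          rw [enorm_mul, mul_assoc]
          gcongr
          exact enorm_inner_le _ _
      _ = ‖v‖ₑ * ∫⁻ p in Set.Ioi (0 : ℝ) ×ˢ (Set.univ : Set E),
            2 * (‖heatExtension u p.1 p.2‖ₑ * ‖heatExtensionGrad g p.1 p.2‖ₑ) := by
          rw [lintegral_mul_const _ hm, lintegral_const_mul _ hm]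
          ring
      _ ≤ ‖v‖ₑ * ENNReal.ofReal Q := by gcongr
  have h2 : ENNReal.ofReal |2 * ∫ p in Set.Ioi (0 : ℝ) ×ˢ (Set.univ : Set E),
      heatExtension u p.1 p.2 * ⟪heatExtensionGrad g p.1 p.2, v⟫| ≤ ENNReal.ofReal (‖v‖ * Q) := by
    rw [← Real.enorm_eq_ofReal_abs, ENNReal.ofReal_mul (norm_nonneg _), ofReal_norm]
    exact h1
  exact (ENNReal.ofReal_le_ofReal_iff (by positivity)).mp h2

/-- **The components of the potential are in `BMO`** (Fefferman–Stein duality step, as in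
`memBMO_of_eCarlesonGradNorm_lt_top_holds`): testing the duality bound with
`g = 1_B (sign(f - f_B) - c_B)`. [folklore] -/
theorem memBMO_inner_potential {u : E → ℝ} {K : ℕ}
    (hfw : Integrable fun w => ((1 + ‖w‖) ^ K)⁻¹ * u w) (hγ : eCarlesonNorm u < ∞) {Φ : E → E}
    (hΦi : LocallyIntegrable Φ)
    (hΦ : ∀ {g : E → ℝ} {x₀ : E} {ρ M : ℝ}, Integrable g → 0 < ρ → (∀ z, |g z| ≤ M) →
        (∀ z, z ∉ ball x₀ ρ → g z = 0) → (∫ z, g z = 0) → ∀ v : E,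
        ∫ x, g x * ⟪Φ x, v⟫ =
          2 * ∫ p in Set.Ioi (0 : ℝ) ×ˢ (Set.univ : Set E),
            heatExtension u p.1 p.2 * ⟪heatExtensionGrad g p.1 p.2, v⟫)
    (v : E) : MemBMO (fun x => ⟪Φ x, v⟫) := by
  obtain ⟨A₁, A₂, hA₁, hA₂, hA⟩ := exists_lintegral_two_mul_enorm_heatExtension_mul_le (E := E)
  have hf : LocallyIntegrable fun x => ⟪Φ x, v⟫ := locallyIntegrable_inner_const hΦi v
  refine ⟨hf, ?_⟩
  obtain ⟨d, hd⟩ : ∃ d : ℕ, d = Module.finrank ℝ E := ⟨_, rfl⟩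
  obtain ⟨Kc, hKc⟩ : ∃ Kc : ℝ, Kc = ‖v‖ * (A₁ * (eCarlesonNorm u).toReal + A₂ * 2 ^ 2) := ⟨_, rfl⟩
  have hKc0 : 0 ≤ Kc := hKc ▸ by positivity
  have key : ∀ (x₀ : E) {ρ : ℝ}, 0 < ρ →
      ∫ w in ball x₀ ρ, |⟪Φ w, v⟫ - ⨍ z in ball x₀ ρ, ⟪Φ z, v⟫| ≤ Kc * ρ ^ d := by
    intro x₀ ρ hρ
    refine setIntegral_abs_sub_average_le hρ
      ((hf.integrableOn_isCompact (isCompact_closedBall x₀ ρ)).mono_set ball_subset_closedBall) ?_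
    intro g hgm hg2 hgs hg0
    -- `g` is integrable
    have hgi : Integrable g := by
      have hg_eq : (ball x₀ ρ).indicator g = g := by
        ext z
        by_cases hz : z ∈ ball x₀ ρ
        · exact Set.indicator_of_mem hz _
        · rw [Set.indicator_of_notMem hz, hgs z hz]
      rw [← hg_eq, integrable_indicator_iff measurableSet_ball]
      exact Measure.integrableOn_of_bounded measure_ball_lt_top.ne hgm
        (Eventually.of_forall fun z => (Real.norm_eq_abs _).trans_le (hg2 z))
    have h := abs_integral_mul_inner_le hfw hγ hΦ hA₁ hA₂ hA hgi hρ hg2 hgs hg0 v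
    have e1 : (fun w => ⟪Φ w, v⟫ * g w) = fun w => g w * ⟪Φ w, v⟫ := by funext w; ring
    rw [e1, ← hd] at *
    calc |∫ w, g w * ⟪Φ w, v⟫| ≤ ‖v‖ * ((A₁ * (eCarlesonNorm u).toReal + A₂ * 2 ^ 2) * ρ ^ d) := h
      _ = Kc * ρ ^ d := by rw [hKc]; ring
  have hV : volume (ball (0 : E) 1) ≠ 0 := (measure_ball_pos volume (0 : E) one_pos).ne'
  have hbound : eBMOSeminorm (fun x => ⟪Φ x, v⟫) ≤ ENNReal.ofReal Kc / volume (ball (0 : E) 1) := by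
    refine iSup_le fun x₀ => iSup₂_le fun ρ hρ => ?_
    have hfB : IntegrableOn (fun x => ⟪Φ x, v⟫) (ball x₀ ρ) :=
      (hf.integrableOn_isCompact (isCompact_closedBall x₀ ρ)).mono_set ball_subset_closedBall
    have hint : Integrable (fun w => ⟪Φ w, v⟫ - ⨍ z in ball x₀ ρ, ⟪Φ z, v⟫) (volume.restrict (ball x₀ ρ)) :=
      Integrable.sub hfB (integrableOn_const measure_ball_lt_top.ne)
    have hρd : ENNReal.ofReal (ρ ^ d) ≠ 0 := (ENNReal.ofReal_pos.mpr (pow_pos hρ d)).ne'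
    have h1 : ∫⁻ y in ball x₀ ρ, ‖⟪Φ y, v⟫ - ⨍ z in ball x₀ ρ, ⟪Φ z, v⟫‖ₑ =
        ENNReal.ofReal (∫ y in ball x₀ ρ, |⟪Φ y, v⟫ - ⨍ z in ball x₀ ρ, ⟪Φ z, v⟫|) := by
      rw [← ofReal_integral_norm_eq_lintegral_enorm hint]
      simp_rw [Real.norm_eq_abs]
    have h2 : volume (ball x₀ ρ) = ENNReal.ofReal (ρ ^ d) * volume (ball (0 : E) 1) := by
      rw [Measure.addHaar_ball_of_pos volume x₀ hρ, ← hd]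
    rw [setLAverage_eq, h1, h2]
    calc ENNReal.ofReal (∫ y in ball x₀ ρ, |⟪Φ y, v⟫ - ⨍ z in ball x₀ ρ, ⟪Φ z, v⟫|) /
          (ENNReal.ofReal (ρ ^ d) * volume (ball (0 : E) 1))
        ≤ ENNReal.ofReal (Kc * ρ ^ d) / (ENNReal.ofReal (ρ ^ d) * volume (ball (0 : E) 1)) := by
          gcongr
          exact key x₀ hρ
      _ = ENNReal.ofReal Kc * ENNReal.ofReal (ρ ^ d) /
            (volume (ball (0 : E) 1) * ENNReal.ofReal (ρ ^ d)) := by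
          rw [ENNReal.ofReal_mul hKc0, mul_comm (ENNReal.ofReal (ρ ^ d)) (volume _)]
      _ = ENNReal.ofReal Kc / volume (ball (0 : E) 1) :=
          ENNReal.mul_div_mul_right _ _ hρd ENNReal.ofReal_ne_top
  exact hbound.trans_lt (ENNReal.div_lt_top ENNReal.ofReal_ne_top hV)

end Potential

/-! ## Calculus for the weak divergence identity -/

section Calculus

variable {E : Type*} [NormedAddCommGroup E] [InnerProductSpace ℝ E] [FiniteDimensional ℝ E]
  [MeasurableSpace E] [BorelSpace E]

/-- **Moving one derivative onto the test function**: for `g ∈ C¹_c` and `t > 0`,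
`⟪∇e^{tΔ}g (y), b⟫ = e^{tΔ}(∂_b g)(y)` (integration by parts against `z ↦ K_t(y - z)`). [folklore] -/
theorem inner_heatExtensionGrad_eq_heatExtension_fderiv {g : E → ℝ} (hg : ContDiff ℝ 1 g)
    (hgc : HasCompactSupport g) {t : ℝ} (ht : 0 < t) (y b : E) :
    ⟪heatExtensionGrad g t y, b⟫ = heatExtension (fun z => fderiv ℝ g z b) t y := by
  have hgcont : Continuous g := hg.continuous
  have hgi : Integrable g := hgcont.integrable_of_hasCompactSupport hgc
  have hg' : Continuous fun z => fderiv ℝ g z b := (hg.continuous_fderiv one_ne_zero).clm_apply continuous_const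
  have hg'c : HasCompactSupport fun z => fderiv ℝ g z b := hgc.fderiv_apply ℝ b
  -- the kernel side
  have hk : ∀ z, HasFDerivAt (fun z => heatKernel t (y - z)) (-(innerSL ℝ (heatKernelGrad t (y - z)))) z :=
    fun z => hasFDerivAt_heatKernel_sub t y z
  have hkd : ∀ z, DifferentiableAt ℝ (fun z => heatKernel t (y - z)) z := fun z => (hk z).differentiableAt
  have hkf : ∀ z, fderiv ℝ (fun z => heatKernel t (y - z)) z b = -⟪heatKernelGrad t (y - z), b⟫ := by
    intro z
    rw [(hk z).fderiv]
    simp [innerSL_apply_apply]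
  have hkc : Continuous fun z : E => heatKernel t (y - z) := continuous_heatKernel_sub t y
  have hkgc : Continuous fun z : E => ⟪heatKernelGrad t (y - z), b⟫ :=
    (continuous_heatKernelGrad_sub t y).inner continuous_const
  -- integration by parts
  have hIBP := integral_mul_fderiv_eq_neg_fderiv_mul_of_integrable (μ := (volume : Measure E))
    (f := g) (g := fun z => heatKernel t (y - z)) (v := b) ?_ ?_ ?_
    (fun z _ => (hg.differentiable one_ne_zero z)) (fun z _ => hkd z)
  · calc ⟪heatExtensionGrad g t y, b⟫ = ∫ z, ⟪g z • heatKernelGrad t (y - z), b⟫ := by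
          rw [heatExtensionGrad, ← integral_real_inner_const (integrable_smul_heatKernelGrad_sub hgi ht y) b]
      _ = -∫ z, g z * fderiv ℝ (fun z => heatKernel t (y - z)) z b := by
          rw [← integral_neg]
          refine integral_congr_ae (Eventually.of_forall fun z => ?_)
          show ⟪g z • heatKernelGrad t (y - z), b⟫ = -(g z * fderiv ℝ (fun z => heatKernel t (y - z)) z b)
          rw [hkf, real_inner_smul_left]; ring
      _ = ∫ z, fderiv ℝ g z b * heatKernel t (y - z) := by rw [hIBP, neg_neg]
      _ = heatExtension (fun z => fderiv ℝ g z b) t y := by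
          show _ = ∫ z, heatKernel t (y - z) * fderiv ℝ g z b
          exact integral_congr_ae (Eventually.of_forall fun z => mul_comm _ _)
  · exact (hg'.mul hkc).integrable_of_hasCompactSupport hg'c.mul_right
  · simp_rw [hkf]
    exact ((hgcont.mul hkgc.neg)).integrable_of_hasCompactSupport hgc.mul_right
  · exact (hgcont.mul hkc).integrable_of_hasCompactSupport hgc.mul_right

/-- **The Laplacian moves onto the test function** (two integrations by parts): for `φ ∈ C²_c`,
`s > 0`, `v ∈ E` and an orthonormal basis `b`,
`∫ (∂ₛK_s)(v - z) φ(z) dz = ∫ K_s(v - z) (Σᵢ ∂ᵢ∂ᵢφ)(z) dz`, where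
`∂ₛK_s(x) = K_s(x)(‖x‖²/(4s²) - d/(2s)) = Σᵢ ⟪D(∇K_s)(x) bᵢ, bᵢ⟫`. [folklore] -/
theorem integral_heatKernel_mul_time_deriv_eq {ι : Type*} [Fintype ι] (b : OrthonormalBasis ι ℝ E)
    {φ : E → ℝ} (hφ : ContDiff ℝ 2 φ) (hφc : HasCompactSupport φ) {s : ℝ} (hs : 0 < s) (v : E) :
    ∫ z, heatKernel s (v - z) * (‖v - z‖ ^ 2 / (4 * s ^ 2) - (Module.finrank ℝ E : ℝ) / (2 * s)) * φ z =
      ∫ z, heatKernel s (v - z) * ∑ i, fderiv ℝ (fun z => fderiv ℝ φ z (b i)) z (b i) := by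
  haveI : CompleteSpace E := FiniteDimensional.complete ℝ E
  -- notation for the kernel and its derivatives along `z ↦ v - z`
  set k : E → ℝ := fun z => heatKernel s (v - z) with hk
  set L : E → (E →L[ℝ] E) := fun x => ((-(2 * s)⁻¹ * heatKernel s x) • ContinuousLinearMap.id ℝ E +
        ((-(2 * s)⁻¹) • (InnerProductSpace.toDual ℝ E (heatKernelGrad s x))).smulRight x) with hL
  have hK1 : ∀ z, HasFDerivAt k (-(innerSL ℝ (heatKernelGrad s (v - z)))) z := fun z => hasFDerivAt_heatKernel_sub s v z
  -- first derivatives of `k` along `b i`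
  set ki : ι → E → ℝ := fun i z => -⟪b i, heatKernelGrad s (v - z)⟫ with hki
  have hk_fderiv : ∀ i z, fderiv ℝ k z (b i) = ki i z := by
    intro i z
    rw [(hK1 z).fderiv]
    simp [hki, innerSL_apply_apply, real_inner_comm]
  -- second derivatives: `∂_{bᵢ} ki i = ⟪bᵢ, L(v - z) bᵢ⟫`
  have hG : ∀ z, HasFDerivAt (fun z : E => heatKernelGrad s (v - z)) ((L (v - z)).comp (-(ContinuousLinearMap.id ℝ E))) z :=
    fun z => (hasFDerivAt_heatKernelGrad s (v - z)).comp z ((hasFDerivAt_id z).const_sub v)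
  have hK2 : ∀ i z, HasFDerivAt (ki i)
      (-((innerSL ℝ (b i)).comp ((L (v - z)).comp (-(ContinuousLinearMap.id ℝ E))))) z :=
    fun i z => ((innerSL ℝ (b i)).hasFDerivAt.comp z (hG z)).neg
  have hki_fderiv : ∀ i z, fderiv ℝ (ki i) z (b i) = ⟪L (v - z) (b i), b i⟫ := by
    intro i z
    rw [(hK2 i z).fderiv]
    simp [innerSL_apply_apply, real_inner_comm]
  -- the trace identity
  have htrace : ∀ z, heatKernel s (v - z) * (‖v - z‖ ^ 2 / (4 * s ^ 2) - (Module.finrank ℝ E : ℝ) / (2 * s)) =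
      ∑ i, fderiv ℝ (ki i) z (b i) := by
    intro z
    simp_rw [hki_fderiv]
    exact (sum_inner_fderiv_heatKernelGrad b hs (v - z)).symm
  -- smoothness and support bookkeeping
  have hφ1 : ContDiff ℝ 1 φ := hφ.of_le one_le_two
  have hgi_cont : ∀ i, Continuous fun z => fderiv ℝ φ z (b i) := fun i =>
    (hφ.continuous_fderiv two_ne_zero).clm_apply continuous_const
  have hgi_diff : ∀ i, ContDiff ℝ 1 fun z => fderiv ℝ φ z (b i) := fun i =>
    (hφ.fderiv_right le_rfl).clm_apply contDiff_const
  have hgi_supp : ∀ i, HasCompactSupport fun z => fderiv ℝ φ z (b i) := fun i => hφc.fderiv_apply ℝ (b i)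
  have hψi_cont : ∀ i, Continuous fun z => fderiv ℝ (fun z => fderiv ℝ φ z (b i)) z (b i) := fun i =>
    ((hgi_diff i).continuous_fderiv one_ne_zero).clm_apply continuous_const
  have hk_cont : Continuous k := continuous_heatKernel_sub s v
  have hki_cont : ∀ i, Continuous (ki i) := fun i => (continuous_const.inner (continuous_heatKernelGrad_sub s v)).neg
  have hki_diff : ∀ i z, DifferentiableAt ℝ (ki i) z := fun i z => (hK2 i z).differentiableAt
  have hkii_cont : ∀ i, Continuous fun z => fderiv ℝ (ki i) z (b i) := by
    intro i
    simp_rw [hki_fderiv]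
    have hKc : Continuous (heatKernel (E := E) s) := Literature.Analysis.UnboundedOperators.continuous_heatKernel s
    have hGc := continuous_heatKernelGrad (E := E) s
    have hLc : Continuous fun z : E => L (v - z) (b i) := by
      simp only [hL, add_apply, FunLike.coe_smul, Pi.smul_apply,
        ContinuousLinearMap.id_apply, ContinuousLinearMap.smulRight_apply, InnerProductSpace.toDual_apply_apply]
      fun_prop
    exact hLc.inner continuous_const
  -- two integrations by parts, term by term
  have hterm : ∀ i, ∫ z, fderiv ℝ (ki i) z (b i) * φ z = ∫ z, k z * fderiv ℝ (fun z => fderiv ℝ φ z (b i)) z (b i) := by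
    intro i
    -- IBP 1: `∫ φ ∂ᵢ(ki) = -∫ ∂ᵢφ ki`
    have h1 := integral_mul_fderiv_eq_neg_fderiv_mul_of_integrable (μ := (volume : Measure E))
      (f := φ) (g := ki i) (v := b i)
      (((hgi_cont i).mul (hki_cont i)).integrable_of_hasCompactSupport (hgi_supp i).mul_right)
      ((hφ.continuous.mul (hkii_cont i)).integrable_of_hasCompactSupport hφc.mul_right)
      ((hφ.continuous.mul (hki_cont i)).integrable_of_hasCompactSupport hφc.mul_right)
      (fun z _ => hφ1.differentiable one_ne_zero z) (fun z _ => hki_diff i z)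
    -- IBP 2: `∫ ∂ᵢφ ∂ᵢk = -∫ ∂ᵢ∂ᵢφ k`
    have h2 := integral_mul_fderiv_eq_neg_fderiv_mul_of_integrable (μ := (volume : Measure E))
      (f := fun z => fderiv ℝ φ z (b i)) (g := k) (v := b i)
      (((hψi_cont i).mul hk_cont).integrable_of_hasCompactSupport ((hgi_supp i).fderiv_apply ℝ (b i)).mul_right)
      (by simp_rw [hk_fderiv]; exact ((hgi_cont i).mul (hki_cont i)).integrable_of_hasCompactSupport (hgi_supp i).mul_right)
      (((hgi_cont i).mul hk_cont).integrable_of_hasCompactSupport (hgi_supp i).mul_right)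
      (fun z _ => (hgi_diff i).differentiable one_ne_zero z) (fun z _ => (hK1 z).differentiableAt)
    simp_rw [hk_fderiv] at h2
    calc ∫ z, fderiv ℝ (ki i) z (b i) * φ z = ∫ z, φ z * fderiv ℝ (ki i) z (b i) :=
          integral_congr_ae (Eventually.of_forall fun z => mul_comm _ _)
      _ = -∫ z, fderiv ℝ φ z (b i) * ki i z := h1
      _ = ∫ z, fderiv ℝ (fun z => fderiv ℝ φ z (b i)) z (b i) * k z := by rw [h2, neg_neg]
      _ = _ := integral_congr_ae (Eventually.of_forall fun z => mul_comm _ _)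
  -- sum up
  calc ∫ z, heatKernel s (v - z) * (‖v - z‖ ^ 2 / (4 * s ^ 2) - (Module.finrank ℝ E : ℝ) / (2 * s)) * φ z
      = ∫ z, ∑ i, fderiv ℝ (ki i) z (b i) * φ z := by
        refine integral_congr_ae (Eventually.of_forall fun z => ?_)
        show heatKernel s (v - z) * (‖v - z‖ ^ 2 / (4 * s ^ 2) - (Module.finrank ℝ E : ℝ) / (2 * s)) * φ z =
          ∑ i, fderiv ℝ (ki i) z (b i) * φ z
        rw [htrace, Finset.sum_mul]
    _ = ∑ i, ∫ z, fderiv ℝ (ki i) z (b i) * φ z := by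
        refine integral_finsetSum _ fun i _ => ?_
        exact ((hkii_cont i).mul hφ.continuous).integrable_of_hasCompactSupport hφc.mul_left
    _ = ∑ i, ∫ z, k z * fderiv ℝ (fun z => fderiv ℝ φ z (b i)) z (b i) := Finset.sum_congr rfl fun i _ => hterm i
    _ = ∫ z, ∑ i, k z * fderiv ℝ (fun z => fderiv ℝ φ z (b i)) z (b i) := by
        refine (integral_finsetSum _ fun i _ => ?_).symm
        exact (hk_cont.mul (hψi_cont i)).integrable_of_hasCompactSupport ((hgi_supp i).fderiv_apply ℝ (b i)).mul_left
    _ = _ := by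
        refine integral_congr_ae (Eventually.of_forall fun z => ?_)
        show ∑ i, k z * fderiv ℝ (fun z => fderiv ℝ φ z (b i)) z (b i) =
          heatKernel s (v - z) * ∑ i, fderiv ℝ (fun z => fderiv ℝ φ z (b i)) z (b i)
        rw [Finset.mul_sum]

end Calculus

/-! ## Symmetry of the caloric extension against a decaying test function; limits -/

section Symmetry

variable {E : Type*} [NormedAddCommGroup E] [InnerProductSpace ℝ E] [FiniteDimensional ℝ E]
  [MeasurableSpace E] [BorelSpace E]

/-- **Symmetry of `e^{tΔ}`**: for tempered `u` (growth `K`) and a measurable `h` with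
`|h(y)| ≤ C (1 + ‖y - x₀‖)^{-(K+d+1)}`, `∫ e^{tΔ}u · h = ∫ u · e^{tΔ}h` (Fubini, `K_t` even). [folklore] -/
theorem integral_heatExtension_mul_eq {u h : E → ℝ} {K : ℕ}
    (hfw : Integrable fun w => ((1 + ‖w‖) ^ K)⁻¹ * u w) (hhm : AEStronglyMeasurable h volume)
    {x₀ : E} {C : ℝ} (hC : ∀ y, |h y| ≤ C * ((1 + ‖y - x₀‖) ^ (K + (Module.finrank ℝ E + 1)))⁻¹)
    {t : ℝ} (ht : 0 < t) :
    ∫ y, heatExtension u t y * h y = ∫ z, u z * heatExtension h t z := by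
  have hu : AEStronglyMeasurable u volume := aestronglyMeasurable_of_growth hfw
  set d : ℕ := Module.finrank ℝ E with hd
  have hC0 : 0 ≤ C := by
    have := (abs_nonneg _).trans (hC x₀)
    simp only [sub_self, norm_zero, add_zero, one_pow, inv_one, mul_one] at this
    exact this
  obtain ⟨C₂, hC₂0, hC₂⟩ := exists_unif_bound_heatKernel (E := E) K ht le_rfl
  have hwt : Integrable fun y : E => ((1 + ‖y - x₀‖) ^ (d + 1))⁻¹ :=
    (integrable_inv_one_add_norm_pow (E := E)).comp_sub_right x₀
  set F : E → E → ℝ := fun y z => heatKernel t (y - z) * u z * h y with hF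
  have hFint : Integrable (Function.uncurry F) (volume.prod volume) := by
    have hmeas : AEStronglyMeasurable (Function.uncurry F) (volume.prod volume) := by
      have hKc : Continuous (heatKernel (E := E) t) := Literature.Analysis.UnboundedOperators.continuous_heatKernel _
      have h1 : Continuous fun p : E × E => heatKernel t (p.1 - p.2) := by fun_prop
      exact (h1.aestronglyMeasurable.mul hu.comp_snd).mul hhm.comp_fst
    refine Integrable.mono' ((hwt.const_mul (C₂ * C * (1 + ‖x₀‖) ^ K)).mul_prod (integrable_growth_abs hfw))
      hmeas (Eventually.of_forall fun p => ?_)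
    rcases p with ⟨y, z⟩
    show ‖heatKernel t (y - z) * u z * h y‖ ≤
      C₂ * C * (1 + ‖x₀‖) ^ K * ((1 + ‖y - x₀‖) ^ (d + 1))⁻¹ * (((1 + ‖z‖) ^ K)⁻¹ * |u z|)
    rw [norm_mul, norm_mul, Real.norm_eq_abs, Real.norm_eq_abs, Real.norm_eq_abs,
      abs_of_pos (show (0 : ℝ) < heatKernel t (y - z) from Literature.Analysis.UnboundedOperators.heatKernel_pos ht _)]
    have hk : heatKernel t (y - z) ≤ C₂ * ((1 + ‖y‖) ^ K * ((1 + ‖z‖) ^ K)⁻¹) := by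
      have h1 := hC₂ t ⟨le_rfl, le_rfl⟩ (y - z)
      have h2 : heatKernel t (y - z) ≤ C₂ * ((1 + ‖y - z‖) ^ K)⁻¹ := by
        rw [← div_eq_mul_inv, le_div_iff₀ (by positivity), mul_comm]; exact h1
      exact h2.trans (mul_le_mul_of_nonneg_left (inv_one_add_norm_sub_pow_le' y z K) hC₂0)
    have hwt' := one_add_norm_pow_mul_inv_le y x₀ K (d + 1)
    calc heatKernel t (y - z) * |u z| * |h y|
        ≤ (C₂ * ((1 + ‖y‖) ^ K * ((1 + ‖z‖) ^ K)⁻¹)) * |u z| * (C * ((1 + ‖y - x₀‖) ^ (K + (d + 1)))⁻¹) :=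
          mul_le_mul (mul_le_mul_of_nonneg_right hk (abs_nonneg _)) (hC y) (abs_nonneg _) (by positivity)
      _ = C₂ * C * ((1 + ‖y‖) ^ K * ((1 + ‖y - x₀‖) ^ (K + (d + 1)))⁻¹) * (((1 + ‖z‖) ^ K)⁻¹ * |u z|) := by ring
      _ ≤ C₂ * C * ((1 + ‖x₀‖) ^ K * ((1 + ‖y - x₀‖) ^ (d + 1))⁻¹) * (((1 + ‖z‖) ^ K)⁻¹ * |u z|) := by gcongr
      _ = _ := by ring
  have hswap := integral_integral_swap hFint
  have lhs : ∫ y, ∫ z, F y z = ∫ y, heatExtension u t y * h y := by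
    refine integral_congr_ae (Eventually.of_forall fun y => ?_)
    show ∫ z, heatKernel t (y - z) * u z * h y = heatExtension u t y * h y
    rw [integral_mul_const]
    rfl
  have rhs : ∫ z, ∫ y, F y z = ∫ z, u z * heatExtension h t z := by
    refine integral_congr_ae (Eventually.of_forall fun z => ?_)
    show ∫ y, heatKernel t (y - z) * u z * h y = u z * heatExtension h t z
    have e1 : (fun y => heatKernel t (y - z) * u z * h y) = fun y => u z * (heatKernel t (z - y) * h y) := by
      funext y; rw [heatKernel_sub_comm]; ring
    rw [e1, integral_const_mul]
    rfl
  rw [← lhs, hswap, rhs]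

omit [InnerProductSpace ℝ E] [FiniteDimensional ℝ E] [MeasurableSpace E] [BorelSpace E] in
/-- A bounded function supported in `B(x₀, ρ)` decays at any polynomial rate around `x₀`. [folklore] -/
theorem abs_le_mul_inv_one_add_pow_of_support [NormedSpace ℝ E] {g : E → ℝ} {x₀ : E} {ρ M : ℝ} (hρ : 0 < ρ)
    (hgM : ∀ z, |g z| ≤ M) (hgs : ∀ z, z ∉ ball x₀ ρ → g z = 0) (N : ℕ) (y : E) :
    |g y| ≤ M * (1 + ρ) ^ N * ((1 + ‖y - x₀‖) ^ N)⁻¹ := by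
  have hM : 0 ≤ M := (abs_nonneg _).trans (hgM x₀)
  by_cases hy : y ∈ ball x₀ ρ
  · have h1 : ‖y - x₀‖ < ρ := mem_ball_iff_norm.mp hy
    have h2 : (1 + ‖y - x₀‖) ^ N ≤ (1 + ρ) ^ N := pow_le_pow_left₀ (by positivity) (by linarith) N
    calc |g y| ≤ M := hgM y
      _ = M * (1 + ρ) ^ N * ((1 + ρ) ^ N)⁻¹ := by field_simp
      _ ≤ M * (1 + ρ) ^ N * ((1 + ‖y - x₀‖) ^ N)⁻¹ := by
          gcongr
  · rw [hgs y hy, abs_zero]; positivity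

/-- **Decay in time tested against `φ`**: `∫ u e^{bΔ}φ → 0` as `b → ∞` for tempered `u` with
finite Carleson quantity and a bounded `φ` supported in a ball (symmetry and the pointwise bound
`|e^{bΔ}u| ≤ C γ^{1/2} b^{-1/2}`). [folklore] -/
theorem tendsto_integral_mul_heatExtension_atTop_of_carleson {u φ : E → ℝ} {K : ℕ}
    (hfw : Integrable fun w => ((1 + ‖w‖) ^ K)⁻¹ * u w) (hγ : eCarlesonNorm u < ∞)
    (hφm : AEStronglyMeasurable φ volume) (hφi : Integrable φ) {x₀ : E} {ρ M : ℝ} (hρ : 0 < ρ)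
    (hφM : ∀ z, |φ z| ≤ M) (hφs : ∀ z, z ∉ ball x₀ ρ → φ z = 0) :
    Tendsto (fun b : ℝ => ∫ z, u z * heatExtension φ b z) atTop (𝓝 0) := by
  obtain ⟨C₀, hC₀0, hC₀⟩ := exists_abs_heatExtension_le (E := E)
  set d : ℕ := Module.finrank ℝ E with hd
  have hsymm : ∀ b : ℝ, 0 < b → ∫ z, u z * heatExtension φ b z = ∫ y, heatExtension u b y * φ y := by
    intro b hb
    exact (integral_heatExtension_mul_eq hfw hφm
      (abs_le_mul_inv_one_add_pow_of_support hρ hφM hφs (K + (d + 1))) hb).symm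
  have hbound : ∀ b : ℝ, 0 < b → |∫ z, u z * heatExtension φ b z| ≤
      C₀ * Real.sqrt (eCarlesonNorm u).toReal / Real.sqrt b * ∫ y, |φ y| := by
    intro b hb
    rw [hsymm b hb]
    calc |∫ y, heatExtension u b y * φ y| ≤ ∫ y, |heatExtension u b y * φ y| := abs_integral_le_integral_abs
      _ ≤ ∫ y, C₀ * Real.sqrt (eCarlesonNorm u).toReal / Real.sqrt b * |φ y| := by
          refine integral_mono_of_nonneg (Eventually.of_forall fun y => abs_nonneg _) (hφi.abs.const_mul _)
            (Eventually.of_forall fun y => ?_)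
          show |heatExtension u b y * φ y| ≤ C₀ * Real.sqrt (eCarlesonNorm u).toReal / Real.sqrt b * |φ y|
          rw [abs_mul]
          exact mul_le_mul_of_nonneg_right (hC₀ hfw hγ hb y) (abs_nonneg _)
      _ = _ := integral_const_mul _ _
  have hlim : Tendsto (fun b : ℝ => C₀ * Real.sqrt (eCarlesonNorm u).toReal / Real.sqrt b * ∫ y, |φ y|) atTop (𝓝 0) := by
    have h1 : Tendsto (fun b : ℝ => (Real.sqrt b)⁻¹) atTop (𝓝 0) :=
      tendsto_inv_atTop_zero.comp (Real.tendsto_sqrt_atTop)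
    have := (h1.const_mul (C₀ * Real.sqrt (eCarlesonNorm u).toReal)).mul_const (∫ y, |φ y|)
    simpa [div_eq_mul_inv] using this
  refine squeeze_zero_norm' ?_ hlim
  filter_upwards [Ioi_mem_atTop (0 : ℝ)] with b hb
  rw [Real.norm_eq_abs]
  exact hbound b hb

omit [MeasurableSpace E] [BorelSpace E] in
/-- General polynomial decay of the heat kernel: `‖c‖^{2(d+j)} K_t(c) ≤ (4π)^{-d/2}(d+j)! 4^{d+j} √t^{d+2j}`. [folklore] -/
theorem norm_pow_mul_heatKernel_le_general {t : ℝ} (ht : 0 < t) (c : E) (j : ℕ) :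
    ‖c‖ ^ (2 * (Module.finrank ℝ E + j)) * heatKernel t c ≤
      (4 * Real.pi) ^ (-(Module.finrank ℝ E : ℝ) / 2) * (Module.finrank ℝ E + j).factorial *
        4 ^ (Module.finrank ℝ E + j) * Real.sqrt t ^ (Module.finrank ℝ E + 2 * j) := by
  set d := Module.finrank ℝ E with hd
  set m := d + j with hm
  set s := Real.sqrt t with hs
  have hs0 : 0 < s := Real.sqrt_pos.2 ht
  have hts : t = s ^ 2 := (Real.sq_sqrt ht.le).symm
  rw [heatKernel_eq_sqrt ht]
  have key : ‖c‖ ^ (2 * m) * Real.exp (-‖c‖ ^ 2 / (4 * t)) ≤ m.factorial * (4 * t) ^ m := by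
    have h := pow_mul_exp_neg_le (a := (4 * t)⁻¹) (by positivity) m (sq_nonneg ‖c‖)
    rw [pow_mul]
    have e1 : -‖c‖ ^ 2 / (4 * t) = -((4 * t)⁻¹ * ‖c‖ ^ 2) := by ring
    rw [e1]
    calc (‖c‖ ^ 2) ^ m * Real.exp (-((4 * t)⁻¹ * ‖c‖ ^ 2)) ≤ m.factorial / ((4 * t)⁻¹) ^ m := h
      _ = m.factorial * (4 * t) ^ m := by rw [inv_pow, div_inv_eq_mul]
  rw [← hd]
  calc ‖c‖ ^ (2 * m) * ((4 * Real.pi) ^ (-(d : ℝ) / 2) * (s ^ d)⁻¹ * Real.exp (-‖c‖ ^ 2 / (4 * t)))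
      = (4 * Real.pi) ^ (-(d : ℝ) / 2) * (s ^ d)⁻¹ * (‖c‖ ^ (2 * m) * Real.exp (-‖c‖ ^ 2 / (4 * t))) := by
        ring
    _ ≤ (4 * Real.pi) ^ (-(d : ℝ) / 2) * (s ^ d)⁻¹ * (m.factorial * (4 * t) ^ m) := by gcongr
    _ = (4 * Real.pi) ^ (-(d : ℝ) / 2) * m.factorial * 4 ^ m * s ^ (d + 2 * j) := by
        rw [hts, mul_pow, ← pow_mul]
        have : s ^ (2 * m) = s ^ d * s ^ (d + 2 * j) := by rw [← pow_add, hm]; ring_nf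
        rw [this]
        field_simp

/-- **Domination for small times, any polynomial order**: for `g` with `|g| ≤ M` vanishing off
`B(x₀, ρ)` and `N`, there is `C` with `|e^{aΔ}g(v)| ≤ C (1 + ‖v - x₀‖)^{-N}` for all `0 < a ≤ 1`
and `v`. [folklore] -/
theorem exists_abs_heatExtension_le_of_le_one_general {g : E → ℝ} {x₀ : E} {ρ M : ℝ}
    (hρ : 0 < ρ) (hgM : ∀ z, |g z| ≤ M) (hgs : ∀ z, z ∉ ball x₀ ρ → g z = 0) (N : ℕ) :
    ∃ C : ℝ, 0 ≤ C ∧ ∀ {a : ℝ}, 0 < a → a ≤ 1 → ∀ v : E,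
      |heatExtension g a v| ≤ C * ((1 + ‖v - x₀‖) ^ N)⁻¹ := by
  set d := Module.finrank ℝ E with hd
  have hM : 0 ≤ M := (abs_nonneg _).trans (hgM x₀)
  set P' : ℝ := (4 * Real.pi) ^ (-(d : ℝ) / 2) * (d + N).factorial * 4 ^ (d + N) * 2 ^ (2 * (d + N)) with hP'
  set Cfar : ℝ := M * (P' * ((2 * ρ) ^ (2 * d + N))⁻¹ * ((1 + 2 * ρ) / (2 * ρ)) ^ N) * volume.real (ball x₀ ρ)
    with hCfar
  set Cnear : ℝ := M * (1 + 2 * ρ) ^ N with hCnear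
  refine ⟨Cfar + Cnear, by positivity, ?_⟩
  intro a ha ha1 v
  have hfar0 : 0 ≤ Cfar * ((1 + ‖v - x₀‖) ^ N)⁻¹ := by positivity
  have hnear0 : 0 ≤ Cnear * ((1 + ‖v - x₀‖) ^ N)⁻¹ := by positivity
  rcases lt_or_ge ‖v - x₀‖ (2 * ρ) with hnear | hfar
  · have h1 := abs_heatExtension_le hgM ha v
    have h2 : M ≤ Cnear * ((1 + ‖v - x₀‖) ^ N)⁻¹ := by
      rw [hCnear, mul_assoc]
      refine le_mul_of_one_le_right hM ?_
      rw [← div_eq_mul_inv, one_le_div (by positivity)]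
      exact pow_le_pow_left₀ (by positivity) (by linarith) _
    calc |heatExtension g a v| ≤ M := h1
      _ ≤ Cnear * ((1 + ‖v - x₀‖) ^ N)⁻¹ := h2
      _ ≤ (Cfar + Cnear) * ((1 + ‖v - x₀‖) ^ N)⁻¹ := by rw [add_mul]; linarith
  · set δ := ‖v - x₀‖ with hδ
    have hδ0 : 0 < δ := by linarith
    have hker : ∀ z ∈ ball x₀ ρ, heatKernel a (v - z) ≤
        P' * ((2 * ρ) ^ (2 * d + N))⁻¹ * ((1 + 2 * ρ) / (2 * ρ)) ^ N * ((1 + δ) ^ N)⁻¹ := by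
      intro z hz
      have hz' : ‖z - x₀‖ < ρ := mem_ball_iff_norm.mp hz
      have hc : δ / 2 ≤ ‖v - z‖ := by
        have := norm_sub_norm_le (v - x₀) (z - x₀)
        rw [sub_sub_sub_cancel_right] at this
        linarith
      have hc0 : 0 < ‖v - z‖ := lt_of_lt_of_le (by positivity) hc
      -- polynomial decay of order `2(d+N)`, uniform for `a ≤ 1`
      have h1 := norm_pow_mul_heatKernel_le_general ha (v - z) N
      rw [← hd] at h1
      have hs1 : Real.sqrt a ^ (d + 2 * N) ≤ 1 := pow_le_one₀ (Real.sqrt_nonneg _) (Real.sqrt_le_one.mpr ha1)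
      set P : ℝ := (4 * Real.pi) ^ (-(d : ℝ) / 2) * (d + N).factorial * 4 ^ (d + N) with hP
      have h2 : ‖v - z‖ ^ (2 * (d + N)) * heatKernel a (v - z) ≤ P := by
        refine h1.trans ?_
        calc P * Real.sqrt a ^ (d + 2 * N) ≤ P * 1 := by gcongr
          _ = P := mul_one _
      have h3 : heatKernel a (v - z) ≤ P * (‖v - z‖ ^ (2 * (d + N)))⁻¹ := by
        rw [← div_eq_mul_inv, le_div_iff₀ (by positivity), mul_comm]; exact h2
      have h4 : (‖v - z‖ ^ (2 * (d + N)))⁻¹ ≤ 2 ^ (2 * (d + N)) * (δ ^ (2 * (d + N)))⁻¹ := by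
        have := pow_le_pow_left₀ (by positivity) hc (2 * (d + N))
        calc (‖v - z‖ ^ (2 * (d + N)))⁻¹ ≤ ((δ / 2) ^ (2 * (d + N)))⁻¹ := inv_anti₀ (by positivity) this
          _ = _ := by rw [div_pow]; field_simp
      have h5 : (δ ^ (2 * (d + N)))⁻¹ ≤ ((2 * ρ) ^ (2 * d + N))⁻¹ * (((1 + 2 * ρ) / (2 * ρ)) ^ N * ((1 + δ) ^ N)⁻¹) := by
        have e1 : (δ ^ (2 * (d + N)))⁻¹ = (δ ^ (2 * d + N))⁻¹ * (δ ^ N)⁻¹ := by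
          rw [← mul_inv, ← pow_add]; ring_nf
        rw [e1]
        exact mul_le_mul (inv_anti₀ (by positivity) (pow_le_pow_left₀ (by positivity) hfar _))
          (inv_pow_le_inv_one_add_pow hρ hfar N) (by positivity) (by positivity)
      calc heatKernel a (v - z) ≤ P * (‖v - z‖ ^ (2 * (d + N)))⁻¹ := h3
        _ ≤ P * (2 ^ (2 * (d + N)) * (δ ^ (2 * (d + N)))⁻¹) := by gcongr
        _ = P' * (δ ^ (2 * (d + N)))⁻¹ := by rw [hP', hP]; ring
        _ ≤ P' * (((2 * ρ) ^ (2 * d + N))⁻¹ * (((1 + 2 * ρ) / (2 * ρ)) ^ N * ((1 + δ) ^ N)⁻¹)) := by gcongr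
        _ = _ := by ring
    have h1 : |heatExtension g a v| ≤ Cfar * ((1 + δ) ^ N)⁻¹ := by
      calc |heatExtension g a v| = ‖∫ z, heatKernel a (v - z) * g z‖ := rfl
        _ ≤ ∫ z, ‖heatKernel a (v - z) * g z‖ := norm_integral_le_integral_norm _
        _ = ∫ z in ball x₀ ρ, ‖heatKernel a (v - z) * g z‖ := by
            rw [setIntegral_eq_integral_of_forall_compl_eq_zero]
            intro z hz; rw [hgs z hz, mul_zero, norm_zero]
        _ ≤ (P' * ((2 * ρ) ^ (2 * d + N))⁻¹ * ((1 + 2 * ρ) / (2 * ρ)) ^ N * ((1 + δ) ^ N)⁻¹ * M) *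
              volume.real (ball x₀ ρ) := by
            refine (Real.le_norm_self _).trans (norm_setIntegral_le_of_norm_le_const measure_ball_lt_top ?_)
            intro z hz
            rw [norm_norm, norm_mul, Real.norm_of_nonneg (show 0 ≤ heatKernel a (v - z) from
              (Literature.Analysis.UnboundedOperators.heatKernel_pos ha _).le), Real.norm_eq_abs]
            exact mul_le_mul (hker z hz) (hgM z) (abs_nonneg _) (by positivity)
        _ = Cfar * ((1 + δ) ^ N)⁻¹ := by rw [hCfar]; ring
    calc |heatExtension g a v| ≤ Cfar * ((1 + δ) ^ N)⁻¹ := h1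
      _ ≤ (Cfar + Cnear) * ((1 + δ) ^ N)⁻¹ := by rw [add_mul]; linarith

/-- **Dominated convergence as `a → 0⁺`, tempered case**: `∫ u e^{aΔ}g → ∫ u g` for `u` of
polynomial growth (any order) and `g` continuous, bounded, supported in a ball. [folklore] -/
theorem tendsto_integral_mul_heatExtension_nhdsWithin_zero_general {u g : E → ℝ} {K : ℕ} {x₀ : E} {ρ M : ℝ}
    (hfw : Integrable fun w => ((1 + ‖w‖) ^ K)⁻¹ * u w)
    (hgc : Continuous g) (hgi : Integrable g) (hρ : 0 < ρ) (hgM : ∀ z, |g z| ≤ M)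
    (hgs : ∀ z, z ∉ ball x₀ ρ → g z = 0) :
    Tendsto (fun a : ℝ => ∫ v, u v * heatExtension g a v) (𝓝[>] 0) (𝓝 (∫ v, u v * g v)) := by
  obtain ⟨C, hC0, hC⟩ := exists_abs_heatExtension_le_of_le_one_general hρ hgM hgs K
  have hfm : AEStronglyMeasurable u volume := aestronglyMeasurable_of_growth hfw
  have hmem : Set.Ioc (0 : ℝ) 1 ∈ 𝓝[>] (0 : ℝ) := Ioc_mem_nhdsGT zero_lt_one
  refine tendsto_integral_filter_of_dominated_convergence
    (bound := fun v => C * (1 + ‖x₀‖) ^ K * ‖((1 + ‖v‖) ^ K)⁻¹ * u v‖) ?_ ?_ ?_ ?_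
  · filter_upwards [hmem] with a ha
    exact hfm.mul (continuous_heatExtension hgi ha.1).aestronglyMeasurable
  · filter_upwards [hmem] with a ha
    refine Eventually.of_forall fun v => ?_
    rw [norm_mul, norm_mul, Real.norm_of_nonneg (by positivity : (0 : ℝ) ≤ ((1 + ‖v‖) ^ K)⁻¹),
      Real.norm_eq_abs, Real.norm_eq_abs]
    have h1 := hC ha.1 ha.2 v
    have h2 := inv_one_add_norm_sub_pow_le v x₀ K
    calc |u v| * |heatExtension g a v| ≤ |u v| * (C * ((1 + ‖v - x₀‖) ^ K)⁻¹) := by gcongr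
      _ ≤ |u v| * (C * ((1 + ‖x₀‖) ^ K * ((1 + ‖v‖) ^ K)⁻¹)) := by gcongr
      _ = C * (1 + ‖x₀‖) ^ K * (((1 + ‖v‖) ^ K)⁻¹ * |u v|) := by ring
  · exact hfw.norm.const_mul _
  · refine Eventually.of_forall fun v => ?_
    exact (tendsto_heatExtension_nhdsWithin_zero hgi hgc.continuousAt).const_mul (u v)

end Symmetry

/-! ## The weak divergence identity `∫ u φ = -∫ ⟪Φ, ∇φ⟫` -/

section WeakDiv

variable {E : Type*} [NormedAddCommGroup E] [InnerProductSpace ℝ E] [FiniteDimensional ℝ E]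
  [MeasurableSpace E] [BorelSpace E]

/-- An integrable function has growth of order `0`. [folklore] -/
theorem integrable_growth_zero {g : E → ℝ} (hg : Integrable g) :
    Integrable fun w => ((1 + ‖w‖) ^ 0)⁻¹ * g w := by
  simpa using hg

/-- For tempered `u`, an atom-like `g` and `s > 0`, `z ↦ u(z) e^{sΔ}g(z)` is integrable. [folklore] -/
theorem integrable_mul_heatExtension_of_growth {u g : E → ℝ} {K : ℕ}
    (hfw : Integrable fun w => ((1 + ‖w‖) ^ K)⁻¹ * u w) (hgi : Integrable g) {x₀ : E} {ρ M : ℝ}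
    (hρ : 0 < ρ) (hgM : ∀ z, |g z| ≤ M) (hgs : ∀ z, z ∉ ball x₀ ρ → g z = 0) {s : ℝ} (hs : 0 < s) :
    Integrable fun z => u z * heatExtension g s z := by
  have hu : AEStronglyMeasurable u volume := aestronglyMeasurable_of_growth hfw
  obtain ⟨C, hC0, hC⟩ := exists_abs_heatExtension_le_of_support hρ hgM hgs K hs le_rfl
  refine ((integrable_growth_abs hfw).const_mul (C * (1 + ‖x₀‖) ^ K)).mono'
    (hu.mul (continuous_heatExtension hgi hs).aestronglyMeasurable) (Eventually.of_forall fun z => ?_)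
  rw [norm_mul, Real.norm_eq_abs, Real.norm_eq_abs]
  have h1 := hC s ⟨le_rfl, le_rfl⟩ z
  have h2 := inv_one_add_norm_sub_pow_le z x₀ K
  calc |u z| * |heatExtension g s z| ≤ |u z| * (C * ((1 + ‖z - x₀‖) ^ K)⁻¹) := by gcongr
    _ ≤ |u z| * (C * ((1 + ‖x₀‖) ^ K * ((1 + ‖z‖) ^ K)⁻¹)) := by gcongr
    _ = C * (1 + ‖x₀‖) ^ K * (((1 + ‖z‖) ^ K)⁻¹ * |u z|) := by ring

/-- **`e^{sΔ}(Δφ) = ∂ₛ e^{sΔ}φ` integrated in time**: for `φ ∈ C²_c` and `0 < a ≤ c`,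
`∫_a^c e^{2tΔ}(Σᵢ∂ᵢ∂ᵢφ)(z) dt = ½ (e^{2cΔ}φ(z) - e^{2aΔ}φ(z))`. [folklore] -/
theorem intervalIntegral_heatExtension_laplacian_eq {ι : Type*} [Fintype ι] (b : OrthonormalBasis ι ℝ E)
    {φ : E → ℝ} (hφ : ContDiff ℝ 2 φ) (hφc : HasCompactSupport φ) {a c : ℝ} (ha : 0 < a) (hac : a ≤ c) (z : E) :
    ∫ t in a..c, heatExtension (fun w => ∑ i, fderiv ℝ (fun w => fderiv ℝ φ w (b i)) w (b i)) (2 * t) z =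
      (1 / 2 : ℝ) * (heatExtension φ (2 * c) z - heatExtension φ (2 * a) z) := by
  have hφi : Integrable φ := hφ.continuous.integrable_of_hasCompactSupport hφc
  have h1 := heatExtension_sub_eq_integral hφi z (by positivity : (0 : ℝ) < 2 * a) (by linarith : 2 * a ≤ 2 * c)
  have h2 : ∫ s in (2 * a)..(2 * c), ∫ w, heatKernel s (z - w) *
      (‖z - w‖ ^ 2 / (4 * s ^ 2) - (Module.finrank ℝ E : ℝ) / (2 * s)) * φ w =
      ∫ s in (2 * a)..(2 * c), heatExtension (fun w => ∑ i, fderiv ℝ (fun w => fderiv ℝ φ w (b i)) w (b i)) s z := by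
    refine intervalIntegral.integral_congr fun s hs => ?_
    rw [Set.uIcc_of_le (by linarith)] at hs
    have hs0 : 0 < s := lt_of_lt_of_le (by positivity) hs.1
    exact integral_heatKernel_mul_time_deriv_eq b hφ hφc hs0 z
  have h3 := intervalIntegral.integral_comp_mul_left (a := a) (b := c)
    (fun s => heatExtension (fun w => ∑ i, fderiv ℝ (fun w => fderiv ℝ φ w (b i)) w (b i)) s z) two_ne_zero
  rw [show (∫ t in a..c, heatExtension (fun w => ∑ i, fderiv ℝ (fun w => fderiv ℝ φ w (b i)) w (b i)) (2 * t) z) =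
    (2 : ℝ)⁻¹ • ∫ s in (2 * a)..(2 * c), heatExtension (fun w => ∑ i, fderiv ℝ (fun w => fderiv ℝ φ w (b i)) w (b i)) s z
    from h3, smul_eq_mul, ← h2, ← h1]
  norm_num

/-- **The slab identity** (the heart of `div Φ = u`): for tempered `u`, `φ ∈ C²_c` with
`tsupport φ ⊆ B(x₀, ρ)` and `0 < a ≤ c`,
`∫∫_{(a,c) × E} e^{tΔ}u · e^{tΔ}(Σᵢ∂ᵢ∂ᵢφ) = ½ (∫ u e^{2cΔ}φ - ∫ u e^{2aΔ}φ)` (symmetry of `e^{tΔ}`,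
the semigroup law, Fubini in time, and `e^{sΔ}Δφ = ∂ₛe^{sΔ}φ`). [folklore] -/
theorem setIntegral_slab_heatExtension_mul_eq {ι : Type*} [Fintype ι] (b : OrthonormalBasis ι ℝ E)
    {u φ : E → ℝ} {K : ℕ} (hfw : Integrable fun w => ((1 + ‖w‖) ^ K)⁻¹ * u w)
    (hφ : ContDiff ℝ 2 φ) (hφc : HasCompactSupport φ) {x₀ : E} {ρ : ℝ} (hρ : 0 < ρ)
    (hsupp : tsupport φ ⊆ ball x₀ ρ) {a c : ℝ} (ha : 0 < a) (hac : a ≤ c) :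
    ∫ p in Set.Ioo a c ×ˢ (Set.univ : Set E),
        heatExtension u p.1 p.2 * heatExtension (fun w => ∑ i, fderiv ℝ (fun w => fderiv ℝ φ w (b i)) w (b i)) p.1 p.2 =
      (1 / 2 : ℝ) * ((∫ z, u z * heatExtension φ (2 * c) z) - ∫ z, u z * heatExtension φ (2 * a) z) := by
  have hu : AEStronglyMeasurable u volume := aestronglyMeasurable_of_growth hfw
  set d : ℕ := Module.finrank ℝ E with hd
  set ψ : E → ℝ := fun w => ∑ i, fderiv ℝ (fun w => fderiv ℝ φ w (b i)) w (b i) with hψ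
  -- `φ` and `ψ` as atoms
  have hφi : Integrable φ := hφ.continuous.integrable_of_hasCompactSupport hφc
  have hgi_diff : ∀ i, ContDiff ℝ 1 fun z => fderiv ℝ φ z (b i) := fun i =>
    (hφ.fderiv_right le_rfl).clm_apply contDiff_const
  have hψc : Continuous ψ := by
    refine continuous_finsetSum _ fun i _ => ?_
    exact ((hgi_diff i).continuous_fderiv one_ne_zero).clm_apply continuous_const
  have hψts : tsupport ψ ⊆ tsupport φ := by
    refine closure_minimal (fun z hz => ?_) (isClosed_tsupport φ)
    by_contra hnot
    exact hz (Finset.sum_eq_zero fun i _ => by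
      have hi : z ∉ tsupport (fun w => fderiv ℝ φ w (b i)) := fun h => hnot (tsupport_fderiv_apply_subset ℝ (b i) h)
      rw [fderiv_of_notMem_tsupport ℝ hi, zero_apply])
  have hψsupp : HasCompactSupport ψ := hφc.of_isClosed_subset (isClosed_tsupport ψ) hψts
  have hψi : Integrable ψ := hψc.integrable_of_hasCompactSupport hψsupp
  obtain ⟨Mψ, hMψ⟩ := hψc.bounded_above_of_compact_support hψsupp
  have hψM : ∀ z, |ψ z| ≤ Mψ := fun z => (Real.norm_eq_abs _).symm.trans_le (hMψ z)
  have hψs : ∀ z, z ∉ ball x₀ ρ → ψ z = 0 := fun z hz =>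
    image_eq_zero_of_notMem_tsupport fun h => hz (hsupp (hψts h))
  obtain ⟨Mφ, hMφ⟩ := hφ.continuous.bounded_above_of_compact_support hφc
  have hφM : ∀ z, |φ z| ≤ Mφ := fun z => (Real.norm_eq_abs _).symm.trans_le (hMφ z)
  have hφs : ∀ z, z ∉ ball x₀ ρ → φ z = 0 := fun z hz => image_eq_zero_of_notMem_tsupport fun h => hz (hsupp h)
  -- Step 1: Fubini on the slab
  obtain ⟨CU, hCU0, hCU⟩ := exists_unif_bound_heatExtension hfw ha hac
  obtain ⟨CN, hCN0, hCN⟩ := exists_abs_heatExtension_le_of_support hρ hψM hψs (K + (d + 1)) ha hac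
  have hwt : Integrable fun y : E => ((1 + ‖y - x₀‖) ^ (d + 1))⁻¹ :=
    (integrable_inv_one_add_norm_pow (E := E)).comp_sub_right x₀
  haveI : IsFiniteMeasure (volume.restrict (Set.Ioo a c)) := ⟨by
    rw [Measure.restrict_apply_univ]; exact measure_Ioo_lt_top⟩
  have hmeasψ : Measurable fun p : ℝ × E => heatExtension ψ p.1 p.2 := measurable_heatExtension hψi.1
  have hslab : Integrable (fun p : ℝ × E => heatExtension u p.1 p.2 * heatExtension ψ p.1 p.2)
      ((volume.restrict (Set.Ioo a c)).prod volume) := by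
    refine Integrable.mono' ((integrable_const (1 : ℝ)).mul_prod (hwt.const_mul (CU * CN * (1 + ‖x₀‖) ^ K)))
      ((measurable_heatExtension hu).mul hmeasψ).aestronglyMeasurable ?_
    refine (ae_fst_mem_Ioo a c).mono fun p ht => ?_
    rcases p with ⟨t, y⟩
    have ht' : t ∈ Set.Icc a c := ⟨ht.1.le, ht.2.le⟩
    show ‖heatExtension u t y * heatExtension ψ t y‖ ≤ 1 * (CU * CN * (1 + ‖x₀‖) ^ K * ((1 + ‖y - x₀‖) ^ (d + 1))⁻¹)
    rw [norm_mul, Real.norm_eq_abs, Real.norm_eq_abs, one_mul]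
    have hwt' := one_add_norm_pow_mul_inv_le y x₀ K (d + 1)
    calc |heatExtension u t y| * |heatExtension ψ t y|
        ≤ (CU * (1 + ‖y‖) ^ K) * (CN * ((1 + ‖y - x₀‖) ^ (K + (d + 1)))⁻¹) :=
          mul_le_mul (hCU t ht' y) (hCN t ht' y) (abs_nonneg _) (by positivity)
      _ = CU * CN * ((1 + ‖y‖) ^ K * ((1 + ‖y - x₀‖) ^ (K + (d + 1)))⁻¹) := by ring
      _ ≤ CU * CN * ((1 + ‖x₀‖) ^ K * ((1 + ‖y - x₀‖) ^ (d + 1))⁻¹) := by gcongr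
      _ = _ := by ring
  rw [volume_restrict_prod_univ, integral_prod _ hslab]
  -- Step 2: symmetry and the semigroup law at each time
  have step2 : ∀ t ∈ Set.Ioo a c, ∫ y, heatExtension u t y * heatExtension ψ t y = ∫ z, u z * heatExtension ψ (2 * t) z := by
    intro t ht
    have ht0 : 0 < t := ha.trans ht.1
    obtain ⟨C', hC'0, hC'⟩ := exists_abs_heatExtension_le_of_support hρ hψM hψs (K + (d + 1)) ht0 le_rfl
    rw [integral_heatExtension_mul_eq hfw (continuous_heatExtension hψi ht0).aestronglyMeasurable
      (fun y => hC' t ⟨le_rfl, le_rfl⟩ y) ht0]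
    refine integral_congr_ae (Eventually.of_forall fun z => ?_)
    show u z * heatExtension (fun y => heatExtension ψ t y) t z = u z * heatExtension ψ (2 * t) z
    congr 1
    rw [two_mul, heatExtension_add_eq_integral (integrable_growth_zero hψi) ht0 ht0 z]
    rfl
  rw [show (∫ t in Set.Ioo a c, ∫ y, heatExtension u t y * heatExtension ψ t y) =
      ∫ t in Set.Ioo a c, ∫ z, u z * heatExtension ψ (2 * t) z from setIntegral_congr_fun measurableSet_Ioo step2]
  -- Step 3: Fubini in `(t, z)`
  obtain ⟨C2, hC20, hC2⟩ := exists_abs_heatExtension_le_of_support hρ hψM hψs K (by positivity : (0 : ℝ) < 2 * a)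
    (by linarith : 2 * a ≤ 2 * c)
  set G : ℝ → E → ℝ := fun t z => u z * heatExtension ψ (2 * t) z with hG
  have hGint : Integrable (Function.uncurry G) ((volume.restrict (Set.Ioo a c)).prod volume) := by
    have hmeas : AEStronglyMeasurable (Function.uncurry G) ((volume.restrict (Set.Ioo a c)).prod volume) := by
      have h1 : Measurable fun p : ℝ × E => heatExtension ψ (2 * p.1) p.2 :=
        hmeasψ.comp ((measurable_fst.const_mul 2).prodMk measurable_snd)
      exact (hu.comp_snd.mul h1.aestronglyMeasurable : _)
    refine Integrable.mono' ((integrable_const (1 : ℝ)).mul_prod ((integrable_growth_abs hfw).const_mul (C2 * (1 + ‖x₀‖) ^ K)))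
      hmeas ?_
    refine (ae_fst_mem_Ioo a c).mono fun p ht => ?_
    rcases p with ⟨t, z⟩
    show ‖u z * heatExtension ψ (2 * t) z‖ ≤ 1 * (C2 * (1 + ‖x₀‖) ^ K * (((1 + ‖z‖) ^ K)⁻¹ * |u z|))
    rw [norm_mul, Real.norm_eq_abs, Real.norm_eq_abs, one_mul]
    have h1 := hC2 (2 * t) ⟨by linarith [ht.1], by linarith [ht.2]⟩ z
    have h2 := inv_one_add_norm_sub_pow_le z x₀ K
    calc |u z| * |heatExtension ψ (2 * t) z| ≤ |u z| * (C2 * ((1 + ‖z - x₀‖) ^ K)⁻¹) := by gcongr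
      _ ≤ |u z| * (C2 * ((1 + ‖x₀‖) ^ K * ((1 + ‖z‖) ^ K)⁻¹)) := by gcongr
      _ = _ := by ring
  have hswap := integral_integral_swap hGint
  rw [show (∫ t in Set.Ioo a c, ∫ z, u z * heatExtension ψ (2 * t) z) = ∫ t in Set.Ioo a c, ∫ z, G t z from rfl, hswap]
  -- Step 4: the time integral
  have step4 : ∀ z, ∫ t in Set.Ioo a c, G t z = u z * ((1 / 2 : ℝ) * (heatExtension φ (2 * c) z - heatExtension φ (2 * a) z)) := by
    intro z
    show ∫ t in Set.Ioo a c, u z * heatExtension ψ (2 * t) z = _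
    rw [integral_const_mul, ← integral_Ioc_eq_integral_Ioo, ← intervalIntegral.integral_of_le hac,
      intervalIntegral_heatExtension_laplacian_eq b hφ hφc ha hac z]
  simp_rw [step4]
  -- Step 5: split
  have hi1 := integrable_mul_heatExtension_of_growth hfw hφi hρ hφM hφs (by linarith : (0 : ℝ) < 2 * c)
  have hi2 := integrable_mul_heatExtension_of_growth hfw hφi hρ hφM hφs (by positivity : (0 : ℝ) < 2 * a)
  have e1 : (fun z => u z * ((1 / 2 : ℝ) * (heatExtension φ (2 * c) z - heatExtension φ (2 * a) z))) =
      fun z => (1 / 2 : ℝ) * (u z * heatExtension φ (2 * c) z - u z * heatExtension φ (2 * a) z) := by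
    funext z; ring
  rw [e1, integral_const_mul, integral_sub hi1 hi2]

omit [FiniteDimensional ℝ E] [MeasurableSpace E] [BorelSpace E] in
/-- Data of a test function as an atom: a ball containing the support. [folklore] -/
theorem exists_ball_of_isTestFunctionOn {φ : E → ℝ} (hφ : IsTestFunctionOn (⊤ : TopologicalSpace.Opens E) φ) :
    ∃ ρ : ℝ, 0 < ρ ∧ tsupport φ ⊆ ball (0 : E) ρ := by
  obtain ⟨R, hR⟩ := hφ.hasCompactSupport.isCompact.isBounded.subset_closedBall (0 : E)
  refine ⟨|R| + 1, by positivity, hR.trans ?_⟩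
  intro z hz
  rw [mem_closedBall, dist_zero_right] at hz
  rw [mem_ball_zero_iff]
  linarith [le_abs_self R]

/-- The mean of a derivative of a compactly supported `C¹` function vanishes. [folklore] -/
theorem integral_fderiv_apply_eq_zero_of_contDiff {φ : E → ℝ} (hφ : ContDiff ℝ 1 φ) (hφc : HasCompactSupport φ) (v : E) :
    ∫ z, fderiv ℝ φ z v = 0 := by
  have h := integral_mul_fderiv_eq_neg_fderiv_mul_of_integrable (μ := (volume : Measure E))
    (f := fun _ : E => (1 : ℝ)) (g := φ) (v := v) ?_ ?_ ?_ (fun z _ => differentiableAt_const _)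
    (fun z _ => hφ.differentiable one_ne_zero z)
  · simpa using h
  · simp
  · simpa using ((hφ.continuous_fderiv one_ne_zero).clm_apply continuous_const).integrable_of_hasCompactSupport
      (hφc.fderiv_apply ℝ v)
  · simpa using hφ.continuous.integrable_of_hasCompactSupport hφc

/-- **The weak divergence identity** `u = div Φ` in `𝓓'(E)` for the potential `Φ` of
`exists_potential` (Koch–Tataru 2001, Theorem 1, `⇐`: `u = Σᵢ ∂ᵢ fⁱ` with `fⁱ = ∂ᵢΔ⁻¹u`): for a
test function `φ`, `∫ u φ = -∫ ⟪Φ, ∇φ⟫`. Proof: `⟪Φ, ∇φ⟫ = Σᵢ ∂ᵢφ ⟪Φ, eᵢ⟫`, each `∂ᵢφ` is a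
mean-zero atom, so by the pairing identity `-∫ ⟪Φ, ∇φ⟫ = -2 ∫∫ e^{tΔ}u e^{tΔ}Δφ`; the slab identity
and the limits `∫ u e^{aΔ}φ → ∫ u φ` (`a → 0⁺`), `∫ u e^{bΔ}φ → 0` (`b → ∞`) conclude. [cite: KochTataruAdvMath2001, Theorem 1] -/
theorem hasWeakDivergenceRepresentation_potential {u : E → ℝ} {K : ℕ} (hul : LocallyIntegrable u)
    (hfw : Integrable fun w => ((1 + ‖w‖) ^ K)⁻¹ * u w) (hγ : eCarlesonNorm u < ∞) {Φ : E → E}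
    (hΦm : StronglyMeasurable Φ) (hΦi : LocallyIntegrable Φ)
    (hΦ : ∀ {g : E → ℝ} {x₀ : E} {ρ M : ℝ}, Integrable g → 0 < ρ → (∀ z, |g z| ≤ M) →
        (∀ z, z ∉ ball x₀ ρ → g z = 0) → (∫ z, g z = 0) → ∀ v : E,
        ∫ x, g x * ⟪Φ x, v⟫ =
          2 * ∫ p in Set.Ioi (0 : ℝ) ×ˢ (Set.univ : Set E),
            heatExtension u p.1 p.2 * ⟪heatExtensionGrad g p.1 p.2, v⟫) :
    HasWeakDivergenceRepresentation u Φ := by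
  refine ⟨hul, hΦi, fun φ hφ => ?_⟩
  have hu : AEStronglyMeasurable u volume := aestronglyMeasurable_of_growth hfw
  set d : ℕ := Module.finrank ℝ E with hd
  set b := stdOrthonormalBasis ℝ E with hb
  have hφ2 : ContDiff ℝ 2 φ := contDiff_infty.1 hφ.contDiff 2
  have hφ1 : ContDiff ℝ 1 φ := contDiff_infty.1 hφ.contDiff 1
  have hφc := hφ.hasCompactSupport
  obtain ⟨ρ, hρ, hsupp⟩ := exists_ball_of_isTestFunctionOn hφ
  have hφi : Integrable φ := hφ.contDiff.continuous.integrable_of_hasCompactSupport hφc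
  obtain ⟨Mφ, hMφ⟩ := hφ.contDiff.continuous.bounded_above_of_compact_support hφc
  have hφM : ∀ z, |φ z| ≤ Mφ := fun z => (Real.norm_eq_abs _).symm.trans_le (hMφ z)
  have hφs : ∀ z, z ∉ ball (0 : E) ρ → φ z = 0 := fun z hz => image_eq_zero_of_notMem_tsupport fun h => hz (hsupp h)
  -- the first derivatives as atoms
  set g : Fin d → E → ℝ := fun i z => fderiv ℝ φ z (b i) with hg
  have hg_diff : ∀ i, ContDiff ℝ 1 (g i) := fun i => (hφ2.fderiv_right le_rfl).clm_apply contDiff_const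
  have hg_cont : ∀ i, Continuous (g i) := fun i => (hg_diff i).continuous
  have hg_supp : ∀ i, HasCompactSupport (g i) := fun i => hφc.fderiv_apply ℝ (b i)
  have hg_ts : ∀ i, tsupport (g i) ⊆ tsupport φ := fun i => tsupport_fderiv_apply_subset ℝ (b i)
  have hgi : ∀ i, Integrable (g i) := fun i => (hg_cont i).integrable_of_hasCompactSupport (hg_supp i)
  have hgs : ∀ i z, z ∉ ball (0 : E) ρ → g i z = 0 := fun i z hz =>
    image_eq_zero_of_notMem_tsupport fun h => hz (hsupp (hg_ts i h))
  have hgM : ∀ i, ∃ M, ∀ z, |g i z| ≤ M := fun i => by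
    obtain ⟨M, hM⟩ := (hg_cont i).bounded_above_of_compact_support (hg_supp i)
    exact ⟨M, fun z => (Real.norm_eq_abs _).symm.trans_le (hM z)⟩
  have hg0 : ∀ i, ∫ z, g i z = 0 := fun i => integral_fderiv_apply_eq_zero_of_contDiff hφ1 hφc (b i)
  set ψ : E → ℝ := fun w => ∑ i, fderiv ℝ (fun w => fderiv ℝ φ w (b i)) w (b i) with hψ
  -- Step A: expand `⟪Φ, ∇φ⟫` in the basis and apply the pairing identity
  have hA : ∫ x, ⟪Φ x, gradient φ x⟫ = 2 * ∫ p in Set.Ioi (0 : ℝ) ×ˢ (Set.univ : Set E),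
      heatExtension u p.1 p.2 * heatExtension ψ p.1 p.2 := by
    have e1 : (fun x => ⟪Φ x, gradient φ x⟫) = fun x => ∑ i, g i x * ⟪Φ x, b i⟫ := by
      funext x
      rw [← b.sum_inner_mul_inner (Φ x) (gradient φ x)]
      refine Finset.sum_congr rfl fun i _ => ?_
      rw [inner_gradient_eq_fderiv]
      ring
    have hint : ∀ i, Integrable fun x => g i x * ⟪Φ x, b i⟫ := fun i => by
      obtain ⟨M, hM⟩ := hgM i
      exact integrable_mul_inner_of_locallyIntegrable hΦi hΦm (hgi i) hM (hgs i) (b i)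
    rw [e1, integral_finsetSum _ (fun i _ => hint i)]
    have e2 : ∀ i, ∫ x, g i x * ⟪Φ x, b i⟫ = 2 * ∫ p in Set.Ioi (0 : ℝ) ×ˢ (Set.univ : Set E),
        heatExtension u p.1 p.2 * ⟪heatExtensionGrad (g i) p.1 p.2, b i⟫ := fun i => by
      obtain ⟨M, hM⟩ := hgM i
      exact hΦ (hgi i) hρ hM (hgs i) (hg0 i) (b i)
    simp_rw [e2]
    rw [← Finset.mul_sum]
    congr 1
    have hint2 : ∀ i, IntegrableOn (fun p : ℝ × E => heatExtension u p.1 p.2 * ⟪heatExtensionGrad (g i) p.1 p.2, b i⟫)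
        (Set.Ioi (0 : ℝ) ×ˢ (Set.univ : Set E)) := fun i => by
      obtain ⟨M, hM⟩ := hgM i
      exact integrableOn_heatExtension_mul_inner_Ioi hfw hγ (hgi i) hρ hM (hgs i) (hg0 i) le_rfl (b i)
    rw [← integral_finsetSum _ (fun i _ => hint2 i)]
    refine setIntegral_congr_fun (measurableSet_Ioi.prod MeasurableSet.univ) fun p hp => ?_
    have ht : 0 < p.1 := hp.1
    rw [← Finset.mul_sum]
    congr 1
    -- `Σᵢ ⟪∇e^{tΔ}gᵢ, bᵢ⟫ = e^{tΔ}ψ`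
    have e3 : ∀ i, ⟪heatExtensionGrad (g i) p.1 p.2, b i⟫ =
        heatExtension (fun z => fderiv ℝ (g i) z (b i)) p.1 p.2 := fun i =>
      inner_heatExtensionGrad_eq_heatExtension_fderiv (hg_diff i) (hg_supp i) ht p.2 (b i)
    simp_rw [e3]
    show ∑ i, ∫ z, heatKernel p.1 (p.2 - z) * fderiv ℝ (g i) z (b i) = ∫ z, heatKernel p.1 (p.2 - z) * ψ z
    rw [← integral_finsetSum]
    · refine integral_congr_ae (Eventually.of_forall fun z => ?_)
      show ∑ i, heatKernel p.1 (p.2 - z) * fderiv ℝ (g i) z (b i) =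
        heatKernel p.1 (p.2 - z) * ∑ i, fderiv ℝ (fun w => fderiv ℝ φ w (b i)) z (b i)
      rw [Finset.mul_sum]
    · intro i _
      have hci : Continuous fun z => fderiv ℝ (g i) z (b i) :=
        ((hg_diff i).continuous_fderiv one_ne_zero).clm_apply continuous_const
      exact integrable_heatKernel_sub_mul (hci.integrable_of_hasCompactSupport ((hg_supp i).fderiv_apply ℝ (b i))) ht _
  -- Step B: the space-time integral of `e^{tΔ}u e^{tΔ}ψ` equals `-½ ∫ u φ`
  have hB : ∫ p in Set.Ioi (0 : ℝ) ×ˢ (Set.univ : Set E), heatExtension u p.1 p.2 * heatExtension ψ p.1 p.2 =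
      -(1 / 2 : ℝ) * ∫ z, u z * φ z := by
    -- integrability on `(0, ∞) × E`, via Step A's integrand
    have hintψ : IntegrableOn (fun p : ℝ × E => heatExtension u p.1 p.2 * heatExtension ψ p.1 p.2)
        (Set.Ioi (0 : ℝ) ×ˢ (Set.univ : Set E)) := by
      have hsum : IntegrableOn (fun p : ℝ × E => ∑ i, heatExtension u p.1 p.2 * ⟪heatExtensionGrad (g i) p.1 p.2, b i⟫)
          (Set.Ioi (0 : ℝ) ×ˢ (Set.univ : Set E)) := by
        refine integrable_finsetSum _ fun i _ => ?_
        obtain ⟨M, hM⟩ := hgM i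
        exact integrableOn_heatExtension_mul_inner_Ioi hfw hγ (hgi i) hρ hM (hgs i) (hg0 i) le_rfl (b i)
      refine hsum.congr_fun (fun p hp => ?_) (measurableSet_Ioi.prod MeasurableSet.univ)
      have ht : 0 < p.1 := hp.1
      show ∑ i, heatExtension u p.1 p.2 * ⟪heatExtensionGrad (g i) p.1 p.2, b i⟫ = heatExtension u p.1 p.2 * heatExtension ψ p.1 p.2
      rw [← Finset.mul_sum]
      congr 1
      have e3 : ∀ i, ⟪heatExtensionGrad (g i) p.1 p.2, b i⟫ =
          heatExtension (fun z => fderiv ℝ (g i) z (b i)) p.1 p.2 := fun i =>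
        inner_heatExtensionGrad_eq_heatExtension_fderiv (hg_diff i) (hg_supp i) ht p.2 (b i)
      simp_rw [e3]
      show ∑ i, ∫ z, heatKernel p.1 (p.2 - z) * fderiv ℝ (g i) z (b i) = ∫ z, heatKernel p.1 (p.2 - z) * ψ z
      rw [← integral_finsetSum]
      · refine integral_congr_ae (Eventually.of_forall fun z => ?_)
        show ∑ i, heatKernel p.1 (p.2 - z) * fderiv ℝ (g i) z (b i) =
          heatKernel p.1 (p.2 - z) * ∑ i, fderiv ℝ (fun w => fderiv ℝ φ w (b i)) z (b i)
        rw [Finset.mul_sum]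
      · intro i _
        have hci : Continuous fun z => fderiv ℝ (g i) z (b i) :=
          ((hg_diff i).continuous_fderiv one_ne_zero).clm_apply continuous_const
        exact integrable_heatKernel_sub_mul (hci.integrable_of_hasCompactSupport ((hg_supp i).fderiv_apply ℝ (b i))) ht _
    -- exhaust `(0, ∞)` by `(aₙ, cₙ)` with `aₙ = (n+2)⁻¹`, `cₙ = n + 2`
    set aseq : ℕ → ℝ := fun n => ((n : ℝ) + 2)⁻¹ with haseq
    set cseq : ℕ → ℝ := fun n => (n : ℝ) + 2 with hcseq
    have ha0 : ∀ n, 0 < aseq n := fun n => by positivity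
    have hac : ∀ n, aseq n ≤ cseq n := fun n => by
      simp only [haseq, hcseq]
      rw [inv_le_iff_one_le_mul₀ (by positivity)]
      nlinarith [n.cast_nonneg (α := ℝ)]
    have ha_tendsto : Tendsto aseq atTop (𝓝 0) := by
      have := tendsto_one_div_add_atTop_nhds_zero_nat (𝕜 := ℝ)
      have h2 : Tendsto (fun n : ℕ => (1 : ℝ) / (((n + 1 : ℕ) : ℝ) + 1)) atTop (𝓝 0) :=
        this.comp (tendsto_add_atTop_nat 1)
      refine h2.congr fun n => ?_
      simp only [haseq]; push_cast; rw [one_div]; ring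
    have hc_tendsto : Tendsto cseq atTop atTop := tendsto_atTop_add_const_right _ 2 tendsto_natCast_atTop_atTop
    have hlim1 : Tendsto (fun n => ∫ p in Set.Ioo (aseq n) (cseq n) ×ˢ (Set.univ : Set E),
        heatExtension u p.1 p.2 * heatExtension ψ p.1 p.2) atTop
        (𝓝 (∫ p in Set.Ioi (0 : ℝ) ×ˢ (Set.univ : Set E), heatExtension u p.1 p.2 * heatExtension ψ p.1 p.2)) := by
      have hunion : (⋃ n, Set.Ioo (aseq n) (cseq n) ×ˢ (Set.univ : Set E)) = Set.Ioi (0 : ℝ) ×ˢ Set.univ := by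
        ext p
        simp only [Set.mem_iUnion, Set.mem_prod, Set.mem_Ioo, Set.mem_univ, and_true, Set.mem_Ioi]
        constructor
        · rintro ⟨n, h1, _⟩; exact (ha0 n).trans h1
        · intro hp
          have e1 := (tendsto_order.1 ha_tendsto).2 p.1 hp
          have e2 := (tendsto_atTop.1 hc_tendsto) (p.1 + 1)
          obtain ⟨n, hn1, hn2⟩ := (e1.and e2).exists
          exact ⟨n, hn1, by linarith⟩
      have h := tendsto_setIntegral_of_monotone (μ := (volume : Measure (ℝ × E)))
        (f := fun p : ℝ × E => heatExtension u p.1 p.2 * heatExtension ψ p.1 p.2)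
        (s := fun n => Set.Ioo (aseq n) (cseq n) ×ˢ (Set.univ : Set E))
        (fun n => measurableSet_Ioo.prod MeasurableSet.univ) ?_ ?_
      · rwa [hunion] at h
      · intro n m hnm
        refine Set.prod_mono (Set.Ioo_subset_Ioo ?_ ?_) subset_rfl
        · simp only [haseq]; gcongr
        · simp only [hcseq]; gcongr
      · rw [hunion]; exact hintψ
    have hlim2 : Tendsto (fun n => ∫ p in Set.Ioo (aseq n) (cseq n) ×ˢ (Set.univ : Set E),
        heatExtension u p.1 p.2 * heatExtension ψ p.1 p.2) atTop (𝓝 (-(1 / 2 : ℝ) * ∫ z, u z * φ z)) := by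
      have e1 : ∀ n, ∫ p in Set.Ioo (aseq n) (cseq n) ×ˢ (Set.univ : Set E),
          heatExtension u p.1 p.2 * heatExtension ψ p.1 p.2 =
          (1 / 2 : ℝ) * ((∫ z, u z * heatExtension φ (2 * cseq n) z) - ∫ z, u z * heatExtension φ (2 * aseq n) z) :=
        fun n => setIntegral_slab_heatExtension_mul_eq b hfw hφ2 hφc hρ hsupp (ha0 n) (hac n)
      simp_rw [e1]
      have hfarlim : Tendsto (fun n => ∫ z, u z * heatExtension φ (2 * cseq n) z) atTop (𝓝 0) :=
        (tendsto_integral_mul_heatExtension_atTop_of_carleson hfw hγ hφi.1 hφi hρ hφM hφs).comp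
          (Tendsto.const_mul_atTop two_pos hc_tendsto)
      have hnearlim : Tendsto (fun n => ∫ z, u z * heatExtension φ (2 * aseq n) z) atTop (𝓝 (∫ z, u z * φ z)) := by
        refine (tendsto_integral_mul_heatExtension_nhdsWithin_zero_general hfw hφ.contDiff.continuous hφi hρ hφM hφs).comp ?_
        rw [tendsto_nhdsWithin_iff]
        refine ⟨by simpa using ha_tendsto.const_mul 2, Eventually.of_forall fun n => ?_⟩
        exact mul_pos two_pos (ha0 n)
      have := (hfarlim.sub hnearlim).const_mul (1 / 2 : ℝ)
      refine this.congr' (Eventually.of_forall fun n => rfl) |>.trans ?_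
      rw [zero_sub, show (1 / 2 : ℝ) * -∫ z, u z * φ z = -(1 / 2 : ℝ) * ∫ z, u z * φ z by ring]
    exact tendsto_nhds_unique hlim1 hlim2
  rw [hA, hB]
  ring

end WeakDiv

end BMOInv

/-! ## Assembly: Koch–Tataru's Theorem 1 from the John–Nirenberg inequality -/

section KochTataru

universe u

variable {E : Type u} [NormedAddCommGroup E] [InnerProductSpace ℝ E] [FiniteDimensional ℝ E]
  [MeasurableSpace E] [BorelSpace E]

open BMOInv in
/-- **Koch–Tataru's converse, in `BMO` form** (Koch–Tataru 2001, Theorem 1, `⇐`, with the role of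
their Lemma 4.1 played by the hand-made potential `Φ`): a locally integrable tempered `u` with
`sup_{x,R} R^{-d}∫₀^{R²}∫_{B(x,R)} |e^{tΔ}u|² < ∞` is the weak divergence of a vector field with
`BMO` components. [cite: KochTataruAdvMath2001, Theorem 1] -/
theorem memBMOInv_of_eCarlesonNorm_lt_top {u : E → ℝ} (hu : LocallyIntegrable u)
    (htemp : ∃ N : ℕ, Integrable fun y => ((1 + ‖y‖ ^ 2) ^ N)⁻¹ * u y) (hfin : eCarlesonNorm u < ∞) :
    MemBMOInv u := by
  obtain ⟨N, hN⟩ := htemp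
  have hfw := integrable_growth_of_tempered hN
  obtain ⟨Φ, hΦm, hΦi, hΦ⟩ := exists_potential hfw hfin
  exact ⟨Φ, fun v => memBMO_inner_potential hfw hfin hΦi hΦ v,
    hasWeakDivergenceRepresentation_potential hu hfw hfin hΦm hΦi hΦ⟩

open BMOInv in
/-- **(D) discharged from the John–Nirenberg inequality**: Koch–Tataru's converse in Carleson
form, `Literature.BMOInv.exists_hasWeakDivergenceRepresentation_of_eCarlesonNorm_lt_top`, follows from
`memBMOInv_of_eCarlesonNorm_lt_top` together with the growth of `BMO` functions (A) and the
Fefferman–Stein bound (B) from `john_nirenberg`. [cite: KochTataruAdvMath2001, Theorem 1] -/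
theorem exists_hasWeakDivergenceRepresentation_of_eCarlesonNorm_lt_top_of_JN (hJN : john_nirenberg.{u, 0}) :
    exists_hasWeakDivergenceRepresentation_of_eCarlesonNorm_lt_top (E := E) := by
  intro u hu htemp hfin
  obtain ⟨Φ, hΦ, hdiv⟩ := memBMOInv_of_eCarlesonNorm_lt_top hu htemp hfin
  obtain ⟨C, hC⟩ := eCarlesonGradNorm_le_of_memBMO_of_john_nirenberg (E := E) hJN
  refine ⟨Φ, hdiv, fun v => ⟨MemBMO.integrable_inv_one_add_norm_pow_mul_holds (hΦ v), ?_⟩⟩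
  exact (hC (hΦ v)).trans_lt (ENNReal.mul_lt_top (by simp) (ENNReal.pow_lt_top (hΦ v).eBMOSeminorm_lt_top))

open BMOInv in
/-- **Koch–Tataru's Theorem 1 from the John–Nirenberg inequality alone**: with (A), (B), (C), (D),
(E) all discharged (this file and its three predecessors), the named fact
`Literature.Analysis.FunctionSpaces.memBMOInv_iff_carleson_heat` (Koch–Tataru 2001, Theorem 1) follows from `Literature.Analysis.FunctionSpaces.john_nirenberg`
(John–Nirenberg 1961, Lemma 1'). [cite: KochTataruAdvMath2001, Theorem 1] -/
theorem memBMOInv_iff_carleson_heat_of_JN (hJN : john_nirenberg.{u, 0}) :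
    memBMOInv_iff_carleson_heat (E := E) :=
  memBMOInv_iff_carleson_heat_of_JN_D hJN (exists_hasWeakDivergenceRepresentation_of_eCarlesonNorm_lt_top_of_JN hJN)

/-- **Koch–Tataru's Theorem 1** (Adv. Math. 157 (2001), Theorem 1), the named fact
`Literature.Analysis.FunctionSpaces.memBMOInv_iff_carleson_heat` of `BMO.lean` discharged: for a locally integrable tempered
`u`, `u ∈ BMO⁻¹` (the weak divergence of a `BMO` vector field) iff
`sup_{x,R} R^{-d}∫₀^{R²}∫_{B(x,R)} |e^{tΔ}u|² < ∞`. All five intermediate facts (A)–(E) of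
`BMOCarleson.lean` and the John–Nirenberg inequality are proved in this cluster
(`BMOCarlesonProofs`, `BMOCarlesonFeffermanStein`, `BMOCarlesonDuality`, `BMOCarlesonConverse`,
this file, `BMOJohnNirenberg`). [cite: KochTataruAdvMath2001, Theorem 1] -/
theorem memBMOInv_iff_carleson_heat_holds : memBMOInv_iff_carleson_heat (E := E) :=
  memBMOInv_iff_carleson_heat_of_JN john_nirenberg_holds

open BMOInv in
/-- **(D) discharged**: Koch–Tataru's converse in their Carleson sense of `BMO`, the named fact
`Literature.Analysis.FunctionSpaces.exists_hasWeakDivergenceRepresentation_of_eCarlesonNorm_lt_top`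
of `BMOCarleson.lean` (Koch–Tataru 2001, Theorem 1, direction `u ∈ BMO⁻¹ ⇒ u = Σ ∂ᵢfⁱ, fⁱ ∈ BMO`,
proof on p. 10–11 via Lemma 4.1): a locally integrable tempered `u` with
`sup_{x,R} R^{-d}∫₀^{R²}∫_{B(x,R)} |e^{tΔ}u|² < ∞` is the weak divergence of a vector field whose
components have Stein growth and finite Carleson `BMO` quantity `eCarlesonGradNorm`. Obtained from
`exists_hasWeakDivergenceRepresentation_of_eCarlesonNorm_lt_top_of_JN` (this file: the potential
`Φ = "∇Δ⁻¹u"`, `div Φ = u`, `Φ ∈ BMO` by duality, then (A) and (B)) and the John–Nirenberg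
inequality `john_nirenberg_holds` (`BMOJohnNirenberg.lean`). [cite: KochTataruAdvMath2001, Theorem 1 and Lemma 4.1] -/
theorem exists_hasWeakDivergenceRepresentation_of_eCarlesonNorm_lt_top_holds :
    exists_hasWeakDivergenceRepresentation_of_eCarlesonNorm_lt_top (E := E) :=
  exists_hasWeakDivergenceRepresentation_of_eCarlesonNorm_lt_top_of_JN john_nirenberg_holds

end KochTataru

end Literature.Analysis.FunctionSpaces
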